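import Literature.Combinatorics.Optimization.GibbsStateSingleTest
import Literature.Combinatorics.Optimization.DensityMatrixApproximationProof
import Literature.Combinatorics.Optimization.JuntaApproximation
import Literature.MathematicalPhysics.QuantumLattice.TraceInequalitiesProofs
import Literature.MathematicalPhysics.QuantumLattice.DuhamelTwoPoint
import Literature.LinearAlgebra.Matrix.RayleighQuotient
import HarnessLib

/-!
# Lee–Raghavendra–Steurer 2015, §4.2: Lemma 4.6 (sparse approximation of density matrices by mirror
# descent) and Theorem 4.5 (approximation by a low-degree square) — PROVED

§4.2 ("Approximation against a family of tests", p. 19–20) of [LeeRaghavendraSteurer2015]: for a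
family `𝒯` of tests with `Δ(𝒯) = sup_{A∈𝒯} ‖A‖` and the dual gauge `[A]_𝒯 = sup_{B∈𝒯} Tr(BA)`, a
high-entropy density matrix is indistinguishable by `𝒯` from (Lemma 4.6) a Gibbs state of few tests and
(Thm 4.5) the square of a low-degree polynomial in one element of `𝒯`.  The tree's
`DensityMatrixApproximation.lean` recorded "NOT here: §4.2 (Thm 4.5–4.8)"; §4.2.1 (Cor 4.7, Thm 4.8,
the diagonal case) is `JuntaApproximation.lean`; this file does the matrix case.  Everything is a
theorem (0 named facts, no `sorry`).

* **Lemma 4.6** (p. 19): "For every `ε > 0`, the following holds. Let `𝒯 ⊆ 𝓜(H)` be a compact set, and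
  let `Q, Q_0 ∈ 𝒟(H)` be density matrices. If one defines `h = ⌈(8/ε²) S(Q‖Q_0) Δ(𝒯)²⌉` then there
  exist `A_1, A_2, …, A_h ∈ 𝒯` such that
  `Q̃ = exp(log Q_0 − (ε/4Δ(𝒯)²) Σ_{i=1}^h A_i)/Tr(exp(log Q_0 − (ε/4Δ(𝒯)²) Σ_{i=1}^h A_i)) ∈ 𝒟(H)`
  satisfies `[Q − Q̃]_𝒯 ≤ ε`."
  — `Lemma46.sparse_approximation` (complex Hermitian matrices on any finite index type, tests
  `−Δ·1 ⪯ A ⪯ Δ·1`, prior `Q_0 = U` the maximally mixed state, `S(Q‖U) = log dim − S(Q)`) and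
  `LeeRaghavendraSteurer2015_lemma46` (the real symmetric vocabulary of `DensityMatrixApproximation.lean`:
  `IsDensityMatrix`, `relEntropy Q (uniformDensity r)`, the approximator `expState η S = e^{ηS}/Tr e^{ηS}`
  through the functional calculus).
  RECORDED. (i) SIGN: with the displayed exponent `log Q_0 − η Σ A_i` and the displayed choice of
  `A_{i+1}` (eq. (unsat): `Tr(A_{i+1} Q − A_{i+1} Q̃_i) > ε`) the potential `S(Q‖Q_t)` INCREASES — the
  line (deriv) "`d/dt S(Q‖Q_t) = Tr(Q d/dt log Q_t) = −Tr(Λ_t(Q − Q_t))`" computes `−d/dt S(Q‖Q_t)`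
  (`S(Q‖Q_t) = Tr Q log Q − Tr Q log Q_t`).  The correct exponent is `log Q_0 + η Σ A_i`, which is what
  the paper itself uses in Cor. 4.7 (`f̃ = exp(+ (ε/4Δ²) Σ g_i)/…`, p. 20) and what is proved here.
  (ii) "there exist `A_1,…,A_h`, `h = ⌈…⌉`" is rendered "`h ≤ ⌈…⌉`" (the printed induction stops at the
  first good iterate `Q̃_i`, `i ≤ h`); we also record the sharper count `h ≤ (16/3) S(Q‖U) Δ²/ε²`.
  (iii) PRIOR.  The prior `Q_0 = U` (the case used by Thm 4.5, Thm 4.8 and §7; `log U` is scalar and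
  cancels in the normalisation) is `Lemma46.sparse_approximation` / `LeeRaghavendraSteurer2015_lemma46`;
  a general POSITIVE DEFINITE prior `Q_0` (the printed "`Q_0 ∈ 𝒟(H)`" needs `S(Q‖Q_0) < ∞`, i.e.
  `supp Q ⊆ supp Q_0`; positive definiteness is the clean sufficient condition) is
  `Lemma46.sparse_approximation_prior` (complex, bound `S(Q‖Q_0) = quantumRelEntropy Q Q_0` of
  `VonNeumannEntropyInequalities.lean`) / `LeeRaghavendraSteurer2015_lemma46_prior` (real,
  `relEntropy Q Q_0`, approximator `expStatePrior Q_0 η S = exp(log Q_0 + ηS)/Tr(…)`), obtained by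
  starting the same descent at `S₀ = η⁻¹ log Q_0` (`Lemma46.sparse_approximation_from`,
  `Lemma46.potential_prior`: `Φ(η⁻¹ log Q_0) = S(Q‖Q_0)`).  By-product: **Klein's inequality**
  `S(Q‖Q_0) ≥ 0` for a density matrix `Q` and a positive definite density matrix `Q_0`
  (`Lemma46.quantumRelEntropy_nonneg`, real form `relEntropy_nonneg`) — the fact "`S(Q‖Q_T) ≥ 0`" the
  printed proof invokes — as a corollary of the tree's Gibbs variational principle (the tree had no
  Klein inequality, cf. the search note in `GibbsVariationalPrinciple.lean`).
  PROOF.  The printed proof is in continuous time (`Q_t` driven by a measurable `Λ_s`, the Duhamel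
  formula (4.5) and the curvature bound (magic) `≤ 2‖X'(t)‖²`); Mathlib has no derivative of the matrix
  exponential along a path, so the same potential argument is run in discrete time, one test per step,
  exactly as in the diagonal case `JuntaApproximation.lean`: the potential
  `Φ(S) = log Tr e^{ηS} − η Tr(QS) − S(Q) = S(Q‖Q̃_S) ≥ 0` (Gibbs variational principle,
  `Matrix.IsHermitian.vonNeumannEntropy_sub_mul_le_log_partitionFn`) starts at `Φ(0) = S(Q‖U)` and drops
  by more than `ηε − η²Δ² = 3ε²/(16Δ²)` at each distinguishing test (`Lemma46.potential_add_lt`), because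
  `log Tr e^{η(S+A)} ≤ log Tr e^{ηS} + η Tr(Q̃_S A) + η²Δ²` (`Lemma46.log_partitionFn_add_le_matrix`):
  Golden–Thompson `Tr e^{ηS+ηA} ≤ Tr(e^{ηS} e^{ηA})` (the tree's `goldenThompson_holds`) reduces this to
  the scalar exponential-moment bound `log E_w e^{ηλ} ≤ η E_w λ + η²Δ²` for the probability weight
  `w_k = (U* Q̃_S U)_{kk}` on an eigenbasis `U` of `A` (`Optimization.log_partitionFn_add_le`).  The
  second-order constant `η²Δ²` (for `2ηΔ ≤ 1`, automatic since a distinguishing test forces `ε < 2Δ`)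
  is better than the printed `2η²Δ²`, whence `16/3 ≤ 8`.
* **Theorem 4.5** (p. 19): "For every `ε ∈ (0, ½)`, the following holds. Let `𝒯 ⊆ 𝓜(H)` be compact
  and convex, and let `Q ∈ 𝒟(H)` be a density matrix. Then there exists a number
  `k ≲ (1 + S(Q‖U)) Δ(𝒯)/ε`, a univariate degree-`k` polynomial `p`, and an element `F ∈ 𝒯` such that
  `Tr(p(F)²) = 1` and `[Q − p(F)²]_𝒯 ≤ ε`." — `LeeRaghavendraSteurer2015_thm45`, real symmetric
  vocabulary, universal constant `C = 100`, for EVERY `ε > 0`, `𝒯` convex and nonempty (compactness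
  unused).  Proof = the printed one (p. 20): Lemma 4.6 with `ε/2`, `F = h⁻¹ Σ A_i ∈ 𝒯` by convexity,
  `λ = hε/(8Δ²) ≤ (8/3) S(Q‖U)/ε`, then Cor. 4.4 / Lemma 4.3 as already formalised for Thm 3.4 = 4.1
  (`Thm34.exp_taylor_relative`, `Thm34.weightedAvg_sub_weightedAvg_le`, `Thm34.sq_sub_sq_le_of_rel` of
  `DensityMatrixApproximationProof.lean`), the comparison `|Tr(B(Q̃ − P))| ≤ 8Δ·3η_T` being done in an
  eigenbasis of `F` with the weights `(UᵀBU)_{kk} ∈ [−Δ, Δ]` (`Thm45.trace_mul_cfc_eq_sum`,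
  `Thm45.abs_conj_diag_le`) — this is eq. (gauge-holder) `[·]_𝒯 ≤ Δ(𝒯)‖·‖_*` for commuting arguments.

Source: J. R. Lee, P. Raghavendra, D. Steurer, *Lower bounds on the size of semidefinite programming
relaxations*, STOC 2015 [LeeRaghavendraSteurer2015]; held text `paper:arxiv-1411.6317` (arXiv
rendering), §4.2 p. 19–20.  Tree search: no matrix multiplicative-weights / matrix mirror-descent
approximation theorem in the tree (`Literature/Computability/Learning/MultiplicativeWeights.lean` is the
classical Arora–Hazan–Kale regret bound); corpus/galaxy presearch found only the source itself.
-/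

noncomputable section

open Finset
open scoped ComplexOrder MatrixOrder Matrix.Norms.L2Operator

namespace Literature.Combinatorics.Optimization

namespace Lemma46

open Matrix hiding partitionFn gibbsWeight
open Literature.MathematicalPhysics.QuantumLattice

variable {n : Type*} [Fintype n] [DecidableEq n]

/-- The iterate `Q̃_S = e^{ηS}/Tr e^{ηS}` of the descent (the tree's Gibbs density matrix
`Z⁻¹ e^{−βS}` at `β = −η`). [cite: LeeRaghavendraSteurer2015, Lemma 4.6 (p. 19, eq. (prescribed))] -/
def iterate (η : ℝ) (S : Matrix n n ℂ) : Matrix n n ℂ :=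
  (Matrix.partitionFn (-η) S)⁻¹ • Matrix.gibbsWeight (-η) S

/-- The mirror-descent potential `Φ(S) = log Tr e^{ηS} − η Re Tr(Q S) − S(Q)`; for a density matrix `Q`
this is the quantum relative entropy `S(Q ‖ Q̃_S)`.
[cite: LeeRaghavendraSteurer2015, proof of Lemma 4.6 (p. 20: the potential S(Q‖Q_t))] -/
def potential (Q : Matrix n n ℂ) (η : ℝ) (S : Matrix n n ℂ) : ℝ :=
  Real.log (Matrix.partitionFn (-η) S).re - η * (Q * S).trace.re -
    Literature.InformationTheory.Entropy.vonNeumannEntropy Q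

/-- `Z = Tr e^{ηS}` is real and positive for Hermitian `S`. [folklore] -/
private theorem partitionFn_re_pos [Nonempty n] {S : Matrix n n ℂ} (hS : S.IsHermitian) (η : ℝ) :
    0 < (Matrix.partitionFn (-η) S).re :=
  (Complex.pos_iff.mp (Matrix.partitionFn_pos (-η) hS)).1

/-- The iterate is a density matrix. [cite: LeeRaghavendraSteurer2015, Lemma 4.6 (p. 19: "Q̃ ∈ 𝒟(H)")] -/
theorem posSemidef_iterate {S : Matrix n n ℂ} (hS : S.IsHermitian) (η : ℝ) :
    (iterate η S).PosSemidef :=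
  hS.posSemidef_gibbsDensity (-η)

/-- The iterate has trace one. [cite: LeeRaghavendraSteurer2015, Lemma 4.6 (p. 19: "Q̃ ∈ 𝒟(H)")] -/
theorem trace_iterate [Nonempty n] {S : Matrix n n ℂ} (hS : S.IsHermitian) (η : ℝ) :
    (iterate η S).trace = 1 :=
  Matrix.trace_gibbsDensity (-η) S (Matrix.partitionFn_pos (-η) hS).ne'

/-- `Φ(S) ≥ 0` — the Gibbs variational principle `S(Q) + η Re Tr(QS) ≤ log Tr e^{ηS}`
(`Matrix.IsHermitian.vonNeumannEntropy_sub_mul_le_log_partitionFn`), i.e. `S(Q‖Q̃_S) ≥ 0`.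
[cite: LeeRaghavendraSteurer2015, proof of Lemma 4.6 (p. 20: "contradicts the fact that S(Q‖Q_T) ≥ 0")] -/
theorem potential_nonneg {Q S : Matrix n n ℂ} (hS : S.IsHermitian) (hQ : Q.PosSemidef)
    (hQ1 : Q.trace = 1) (η : ℝ) : 0 ≤ potential Q η S := by
  have h := hS.vonNeumannEntropy_sub_mul_le_log_partitionFn (-η) hQ hQ1
  unfold potential
  linarith

/-- `Φ(0) = log dim − S(Q) = S(Q‖U)` (the descent starts at the maximally mixed state).
[cite: LeeRaghavendraSteurer2015, proof of Lemma 4.6 (p. 20: "Q̃_0 = U")] -/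
theorem potential_zero (Q : Matrix n n ℂ) (η : ℝ) :
    potential Q η 0 = Real.log (Fintype.card n) -
      Literature.InformationTheory.Entropy.vonNeumannEntropy Q := by
  simp [potential, Matrix.partitionFn, Matrix.gibbsWeight, NormedSpace.exp_zero, Matrix.trace_one]

/-! ### Traces against a function of one Hermitian test: classical expectations -/

/-- `Re Tr(ρ · V diag(d) V*) = Σ_k Re (V* ρ V)_{kk} · d_k` for real `d`. [folklore] -/
private theorem re_trace_mul_conj_diagonal (ρ V : Matrix n n ℂ) (d : n → ℝ) :
    (ρ * (V * diagonal (fun k => (d k : ℂ)) * star V)).trace.re =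
      ∑ k, ((star V * ρ * V) k k).re * d k := by
  have h1 : ρ * (V * diagonal (fun k => (d k : ℂ)) * star V) =
      (ρ * V * diagonal (fun k => (d k : ℂ))) * star V := by
    simp only [Matrix.mul_assoc]
  rw [h1, trace_mul_comm, ← Matrix.mul_assoc, ← Matrix.mul_assoc]
  simp only [Matrix.trace, Matrix.diag_apply, Matrix.mul_diagonal, Complex.re_sum,
    Complex.re_mul_ofReal]

/-- The diagonal of `V* ρ V` for a density matrix `ρ` and a unitary `V` is a probability weight.
[folklore] -/
private theorem isProbWeight_conj_diag {ρ V : Matrix n n ℂ} (hρ : ρ.PosSemidef) (hρ1 : ρ.trace = 1)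
    (hV : V ∈ Matrix.unitaryGroup n ℂ) :
    IsProbWeight (fun k => ((star V * ρ * V) k k).re) where
  nonneg k := by
    have h := Literature.LinearAlgebra.Matrix.re_conj_apply_nonneg_of_posSemidef hρ V k
    simpa using h
  sum_eq_one := by
    have h1 : ∑ k, ((star V * ρ * V) k k).re = ((star V * ρ * V).trace).re := by
      simp [Matrix.trace, Complex.re_sum]
    rw [h1, trace_mul_cycle, Matrix.mem_unitaryGroup_iff.mp hV, Matrix.one_mul, hρ1,
      Complex.one_re]

/-- `Re Tr(ρ A) = Σ_k w_k λ_k` in an eigenbasis of the Hermitian `A`. [folklore] -/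
private theorem re_trace_mul_eq_muExpect (ρ : Matrix n n ℂ) {A : Matrix n n ℂ} (hA : A.IsHermitian) :
    (ρ * A).trace.re =
      muExpect (fun k => ((star (hA.eigenvectorUnitary : Matrix n n ℂ) * ρ *
        (hA.eigenvectorUnitary : Matrix n n ℂ)) k k).re) hA.eigenvalues := by
  conv_lhs => rw [hA.spectral_theorem, Unitary.conjStarAlgAut_apply]
  rw [show (diagonal (RCLike.ofReal ∘ hA.eigenvalues) : Matrix n n ℂ) =
      diagonal (fun k => (hA.eigenvalues k : ℂ)) from rfl, re_trace_mul_conj_diagonal]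
  rfl

/-- `Re Tr(ρ e^{ηA}) = Σ_k w_k e^{ηλ_k}` in an eigenbasis of the Hermitian `A`. [folklore] -/
private theorem re_trace_mul_gibbsWeight_eq_partitionFn (ρ : Matrix n n ℂ) {A : Matrix n n ℂ}
    (hA : A.IsHermitian) (η : ℝ) :
    (ρ * Matrix.gibbsWeight (-η) A).trace.re =
      partitionFn (fun k => ((star (hA.eigenvectorUnitary : Matrix n n ℂ) * ρ *
        (hA.eigenvectorUnitary : Matrix n n ℂ)) k k).re) η hA.eigenvalues := by
  rw [hA.gibbsWeight_eq (-η)]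
  have : (diagonal fun i => (Real.exp (-(-η * hA.eigenvalues i)) : ℂ)) =
      diagonal fun k => ((Real.exp (η * hA.eigenvalues k) : ℝ) : ℂ) := by
    congr 1; funext k; simp
  rw [this, re_trace_mul_conj_diagonal]
  rfl

/-- `Re(Δ · u_k* u_k) = Δ` for a unit eigenvector `u_k`. [folklore] -/
private theorem re_ofReal_mul_self_dotProduct {A : Matrix n n ℂ} (hA : A.IsHermitian) (k : n) (Δ : ℝ) :
    RCLike.re ((Δ : ℂ) * star ⇑(hA.eigenvectorBasis k) ⬝ᵥ ⇑(hA.eigenvectorBasis k)) = Δ := by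
  have hxx : RCLike.re (star ⇑(hA.eigenvectorBasis k) ⬝ᵥ ⇑(hA.eigenvectorBasis k)) = 1 := by
    rw [Literature.LinearAlgebra.Matrix.RayleighQuotient.re_star_dotProduct_self,
      Literature.LinearAlgebra.Matrix.RayleighQuotient.sum_norm_sq_eigenvectorBasis]
  rw [RCLike.re_to_complex] at hxx ⊢
  rw [Complex.re_ofReal_mul, hxx, mul_one]

/-- If `Δ·1 − A ⪰ 0` then every eigenvalue of `A` is `≤ Δ`. [folklore] -/
private theorem eigenvalues_le_of_posSemidef {A : Matrix n n ℂ} (hA : A.IsHermitian) {Δ : ℝ}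
    (h : ((Δ : ℂ) • (1 : Matrix n n ℂ) - A).PosSemidef) (k : n) : hA.eigenvalues k ≤ Δ := by
  have h1 := h.re_dotProduct_nonneg ⇑(hA.eigenvectorBasis k)
  rw [sub_mulVec, smul_mulVec, one_mulVec, dotProduct_sub, dotProduct_smul, smul_eq_mul,
    map_sub, Literature.LinearAlgebra.Matrix.RayleighQuotient.form_eigenvectorBasis,
    RCLike.ofReal_re, re_ofReal_mul_self_dotProduct hA k] at h1
  exact sub_nonneg.mp h1

/-- If `Δ·1 + A ⪰ 0` then every eigenvalue of `A` is `≥ −Δ`. [folklore] -/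
private theorem neg_le_eigenvalues_of_posSemidef {A : Matrix n n ℂ} (hA : A.IsHermitian) {Δ : ℝ}
    (h : ((Δ : ℂ) • (1 : Matrix n n ℂ) + A).PosSemidef) (k : n) : -Δ ≤ hA.eigenvalues k := by
  have h1 := h.re_dotProduct_nonneg ⇑(hA.eigenvectorBasis k)
  rw [add_mulVec, smul_mulVec, one_mulVec, dotProduct_add, dotProduct_smul, smul_eq_mul,
    map_add, Literature.LinearAlgebra.Matrix.RayleighQuotient.form_eigenvectorBasis,
    RCLike.ofReal_re, re_ofReal_mul_self_dotProduct hA k] at h1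
  linarith

/-- `|λ_k| ≤ Δ` for a test with `−Δ·1 ⪯ A ⪯ Δ·1`. [cite: LeeRaghavendraSteurer2015, §4.2 (p. 19: Δ(𝒯) = sup ‖A‖)] -/
theorem abs_eigenvalues_le {A : Matrix n n ℂ} (hA : A.IsHermitian) {Δ : ℝ}
    (hle : ((Δ : ℂ) • (1 : Matrix n n ℂ) - A).PosSemidef)
    (hge : ((Δ : ℂ) • (1 : Matrix n n ℂ) + A).PosSemidef) (k : n) : |hA.eigenvalues k| ≤ Δ :=
  abs_le.mpr ⟨neg_le_eigenvalues_of_posSemidef hA hge k, eigenvalues_le_of_posSemidef hA hle k⟩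

/-- `|Re Tr(A ρ)| ≤ Δ` for a density matrix `ρ` and a test `−Δ·1 ⪯ A ⪯ Δ·1` (eq. (gauge-holder) with
`‖ρ‖_* = 1`). [cite: LeeRaghavendraSteurer2015, §4.2 (p. 19, eq. (4.4): |[A]_𝒯| ≤ Δ(𝒯)‖A‖_*)] -/
theorem abs_re_trace_mul_le {A ρ : Matrix n n ℂ} (hA : A.IsHermitian) {Δ : ℝ}
    (hle : ((Δ : ℂ) • (1 : Matrix n n ℂ) - A).PosSemidef)
    (hge : ((Δ : ℂ) • (1 : Matrix n n ℂ) + A).PosSemidef) (hρ : ρ.PosSemidef) (hρ1 : ρ.trace = 1) :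
    |(A * ρ).trace.re| ≤ Δ := by
  rw [trace_mul_comm, re_trace_mul_eq_muExpect ρ hA]
  have hw := isProbWeight_conj_diag hρ hρ1 hA.eigenvectorUnitary.2
  have h := hw.abs_muExpect_mul_le (g := hA.eigenvalues) (p := fun _ => 1)
    (abs_eigenvalues_le hA hle hge) (fun _ => zero_le_one)
  rw [hw.muExpect_const, mul_one] at h
  simpa using h

omit [Fintype n] [DecidableEq n] in
/-- A finite sum of Hermitian matrices is Hermitian. [folklore] -/
private theorem isHermitian_sum {h : ℕ} {As : Fin h → Matrix n n ℂ} (hAs : ∀ l, (As l).IsHermitian) :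
    (∑ l, As l).IsHermitian :=
  Finset.sum_induction _ (fun M : Matrix n n ℂ => M.IsHermitian) (fun _ _ ha hb => ha.add hb)
    Matrix.isHermitian_zero (fun l _ => hAs l)

/-! ### The one inequality of the descent (Golden–Thompson + the classical one-step bound) -/

/-- **One step of the matrix descent** (discrete replacement of the Duhamel computation (4.5)–(4.6)
/(magic)): for Hermitian `S`, a test `−Δ·1 ⪯ A ⪯ Δ·1` and a step size with `2ηΔ ≤ 1`,
`log Tr e^{η(S+A)} ≤ log Tr e^{ηS} + η Tr(Q̃_S A) + η²Δ²`.  Proof: Golden–Thompson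
`Tr e^{ηS+ηA} ≤ Tr(e^{ηS} e^{ηA})` (`goldenThompson_holds`), `Tr(e^{ηS} e^{ηA}) = Z_S · Tr(Q̃_S e^{ηA})`,
and in an eigenbasis of `A` the number `Tr(Q̃_S e^{ηA}) = Σ_k w_k e^{ηλ_k}` is a classical exponential
moment under the probability weight `w_k = (U* Q̃_S U)_{kk}` with `|λ_k| ≤ Δ`, bounded by the classical
one-step lemma `Optimization.log_partitionFn_add_le` (`log E_w e^{ηλ} ≤ η E_w λ + η²Δ²`).
[cite: LeeRaghavendraSteurer2015, proof of Lemma 4.6 (p. 19–20, eq. (magic))] -/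
theorem log_partitionFn_add_le_matrix [Nonempty n] {S A : Matrix n n ℂ} (hS : S.IsHermitian)
    (hA : A.IsHermitian) {η Δ : ℝ} (hη : 0 ≤ η)
    (hle : ((Δ : ℂ) • (1 : Matrix n n ℂ) - A).PosSemidef)
    (hge : ((Δ : ℂ) • (1 : Matrix n n ℂ) + A).PosSemidef) (hηΔ : 2 * η * Δ ≤ 1) :
    Real.log (Matrix.partitionFn (-η) (S + A)).re ≤
      Real.log (Matrix.partitionFn (-η) S).re + η * (iterate η S * A).trace.re + η ^ 2 * Δ ^ 2 := by
  -- the probability weight `w_k = (U* Q̃_S U)_{kk}` in an eigenbasis `U` of `A`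
  have hw := isProbWeight_conj_diag (posSemidef_iterate hS η) (trace_iterate hS η)
    hA.eigenvectorUnitary.2
  -- the classical one-step bound for `w` and the eigenvalues of `A`
  have hcl := Optimization.log_partitionFn_add_le hw hη (g := hA.eigenvalues)
    (abs_eigenvalues_le hA hle hge) hηΔ (fun _ => (0 : ℝ))
  have hcl' : Real.log (partitionFn (fun k => ((star (hA.eigenvectorUnitary : Matrix n n ℂ) *
        iterate η S * (hA.eigenvectorUnitary : Matrix n n ℂ)) k k).re) η hA.eigenvalues) ≤
      η * muExpect (fun k => ((star (hA.eigenvectorUnitary : Matrix n n ℂ) *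
        iterate η S * (hA.eigenvectorUnitary : Matrix n n ℂ)) k k).re) hA.eigenvalues +
        η ^ 2 * Δ ^ 2 := by
    simpa [hw.partitionFn_zero, hw.gibbsDensity_zero] using hcl
  have hE := re_trace_mul_eq_muExpect (iterate η S) hA
  have hP := re_trace_mul_gibbsWeight_eq_partitionFn (iterate η S) hA η
  -- Golden–Thompson
  have hGT : (Matrix.partitionFn (-η) (S + A)).re ≤
      (Matrix.gibbsWeight (-η) S * Matrix.gibbsWeight (-η) A).trace.re := by
    have h := goldenThompson_holds (𝕜 := ℂ) (-((-η : ℝ) : ℂ) • S) (-((-η : ℝ) : ℂ) • A)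
      (Matrix.isHermitian_neg_smul (-η) hS) (Matrix.isHermitian_neg_smul (-η) hA)
    rw [← smul_add] at h
    simpa [Matrix.partitionFn, Matrix.gibbsWeight] using h
  have hne : Matrix.partitionFn (-η) S ≠ 0 := (Matrix.partitionFn_pos (-η) hS).ne'
  have hZpos : 0 < (Matrix.partitionFn (-η) S).re := partitionFn_re_pos hS η
  have hZ'pos : 0 < (Matrix.partitionFn (-η) (S + A)).re := partitionFn_re_pos (hS.add hA) η
  -- `Tr(e^{ηS} e^{ηA}) = Z_S · Tr(Q̃_S e^{ηA})`
  have hfac : (Matrix.gibbsWeight (-η) S * Matrix.gibbsWeight (-η) A).trace.re =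
      (Matrix.partitionFn (-η) S).re * (iterate η S * Matrix.gibbsWeight (-η) A).trace.re := by
    have h1 : Matrix.gibbsWeight (-η) S = Matrix.partitionFn (-η) S • iterate η S := by
      rw [iterate, smul_inv_smul₀ hne]
    have him : (Matrix.partitionFn (-η) S).im = 0 := by
      rw [hS.partitionFn_eq_ofReal, Complex.ofReal_im]
    rw [h1, Matrix.smul_mul, Matrix.trace_smul, smul_eq_mul, Complex.mul_re, him, zero_mul,
      sub_zero]
  have hPpos := hw.partitionFn_pos η hA.eigenvalues
  rw [hP] at hfac
  calc Real.log (Matrix.partitionFn (-η) (S + A)).re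
      ≤ Real.log ((Matrix.partitionFn (-η) S).re * partitionFn (fun k =>
          ((star (hA.eigenvectorUnitary : Matrix n n ℂ) * iterate η S *
            (hA.eigenvectorUnitary : Matrix n n ℂ)) k k).re) η hA.eigenvalues) := by
        apply Real.log_le_log hZ'pos
        rw [← hfac]
        exact hGT
    _ = Real.log (Matrix.partitionFn (-η) S).re + Real.log (partitionFn (fun k =>
          ((star (hA.eigenvectorUnitary : Matrix n n ℂ) * iterate η S *
            (hA.eigenvectorUnitary : Matrix n n ℂ)) k k).re) η hA.eigenvalues) :=
        Real.log_mul hZpos.ne' hPpos.ne'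
    _ ≤ _ := by rw [hE]; linarith

/-- **Descent step**: a test `−Δ·1 ⪯ A ⪯ Δ·1` distinguishing `Q` from the iterate,
`Re Tr(A(Q − Q̃_S)) > ε`, lowers the potential by more than `3ε²/(16Δ²)` at the printed step size
`η = ε/(4Δ²)` (a distinguishing test forces `ε < 2Δ`, which is the side condition `2ηΔ ≤ 1`).
[cite: LeeRaghavendraSteurer2015, proof of Lemma 4.6 (p. 20, eq. (deriv)/(ensure)/(unsat))] -/
theorem potential_add_lt [Nonempty n] {Q S A : Matrix n n ℂ} (hQ : Q.PosSemidef)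
    (hQ1 : Q.trace = 1) (hS : S.IsHermitian) (hA : A.IsHermitian) {Δ ε : ℝ} (hΔ : 0 < Δ)
    (hε : 0 < ε) (hle : ((Δ : ℂ) • (1 : Matrix n n ℂ) - A).PosSemidef)
    (hge : ((Δ : ℂ) • (1 : Matrix n n ℂ) + A).PosSemidef)
    (hdist : ε < (A * (Q - iterate (ε / (4 * Δ ^ 2)) S)).trace.re) :
    potential Q (ε / (4 * Δ ^ 2)) (S + A) <
      potential Q (ε / (4 * Δ ^ 2)) S - 3 * ε ^ 2 / (16 * Δ ^ 2) := by
  set η := ε / (4 * Δ ^ 2) with hη_def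
  have hsplit : (A * (Q - iterate η S)).trace.re =
      (A * Q).trace.re - (A * iterate η S).trace.re := by
    rw [Matrix.mul_sub, Matrix.trace_sub, Complex.sub_re]
  rw [hsplit] at hdist
  -- a distinguishing test forces ε < 2Δ
  have hε2Δ : ε < 2 * Δ := by
    have h1 := abs_re_trace_mul_le hA hle hge hQ hQ1
    have h2 := abs_re_trace_mul_le hA hle hge (posSemidef_iterate hS η) (trace_iterate hS η)
    have := (abs_le.mp h1).2
    have := (abs_le.mp h2).1
    linarith
  have hη : 0 < η := by positivity
  have hηΔ : 2 * η * Δ ≤ 1 := by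
    rw [hη_def, show 2 * (ε / (4 * Δ ^ 2)) * Δ = ε / (2 * Δ) by field_simp; ring,
      div_le_one (by positivity)]
    linarith
  have hstep := log_partitionFn_add_le_matrix hS hA hη.le hle hge hηΔ
  have hQsplit : (Q * (S + A)).trace.re = (Q * S).trace.re + (Q * A).trace.re := by
    rw [Matrix.mul_add, Matrix.trace_add, Complex.add_re]
  rw [trace_mul_comm A Q, trace_mul_comm A (iterate η S)] at hdist
  have hkey := mul_lt_mul_of_pos_left hdist hη
  have hκ : η * ε - η ^ 2 * Δ ^ 2 = 3 * ε ^ 2 / (16 * Δ ^ 2) := by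
    rw [hη_def]; field_simp; ring
  unfold potential
  rw [hQsplit]
  nlinarith

/-! ### The descent -/

/-- The descent, run for `i` rounds from `Q̃_0 = U`: either a good iterate was reached after `j ≤ i`
steps, or `i` forced steps were taken; in both cases `Φ ≤ S(Q‖U) − j·3ε²/(16Δ²)`.
[cite: LeeRaghavendraSteurer2015, proof of Lemma 4.6 (p. 20: "we define the elements A_1,…,A_h … inductively")] -/
theorem iterate_descent [Nonempty n] {Q : Matrix n n ℂ} (hQ : Q.PosSemidef) (hQ1 : Q.trace = 1)
    {𝒯 : Set (Matrix n n ℂ)} {Δ ε : ℝ} (hΔ : 0 < Δ) (hε : 0 < ε)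
    (h𝒯 : ∀ A ∈ 𝒯, A.IsHermitian ∧ ((Δ : ℂ) • (1 : Matrix n n ℂ) - A).PosSemidef ∧
      ((Δ : ℂ) • (1 : Matrix n n ℂ) + A).PosSemidef) (i : ℕ) :
    ∃ (j : ℕ) (As : Fin j → Matrix n n ℂ), j ≤ i ∧ (∀ l, As l ∈ 𝒯) ∧
      potential Q (ε / (4 * Δ ^ 2)) (∑ l, As l) ≤
        (Real.log (Fintype.card n) - Literature.InformationTheory.Entropy.vonNeumannEntropy Q) -
          j * (3 * ε ^ 2 / (16 * Δ ^ 2)) ∧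
      ((∀ B ∈ 𝒯, (B * (Q - iterate (ε / (4 * Δ ^ 2)) (∑ l, As l))).trace.re ≤ ε) ∨ j = i) := by
  induction i with
  | zero =>
    refine ⟨0, Fin.elim0, le_rfl, fun l => l.elim0, ?_, Or.inr rfl⟩
    simp only [univ_eq_empty, sum_empty, Nat.cast_zero, zero_mul, sub_zero]
    rw [potential_zero]
  | succ i ih =>
    obtain ⟨j, As, hji, hAs, hpot, hgood⟩ := ih
    rcases hgood with hgood | hji'
    · exact ⟨j, As, hji.trans (Nat.le_succ i), hAs, hpot, Or.inl hgood⟩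
    · by_cases hG : ∀ B ∈ 𝒯, (B * (Q - iterate (ε / (4 * Δ ^ 2)) (∑ l, As l))).trace.re ≤ ε
      · exact ⟨j, As, hji.trans (Nat.le_succ i), hAs, hpot, Or.inl hG⟩
      · push Not at hG
        obtain ⟨A, hA𝒯, hdist⟩ := hG
        have hSh : (∑ l, As l).IsHermitian := isHermitian_sum fun l => (h𝒯 _ (hAs l)).1
        have hlt := potential_add_lt hQ hQ1 hSh (h𝒯 A hA𝒯).1 hΔ hε (h𝒯 A hA𝒯).2.1
          (h𝒯 A hA𝒯).2.2 hdist
        refine ⟨j + 1, Fin.snoc As A, by omega, ?_, ?_, Or.inr (by omega)⟩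
        · intro l
          refine Fin.lastCases ?_ (fun l => ?_) l
          · simpa using hA𝒯
          · simpa using hAs l
        · have hsum : (∑ l : Fin (j + 1), (Fin.snoc As A : Fin (j + 1) → Matrix n n ℂ) l) =
              (∑ l, As l) + A := by
            rw [Fin.sum_univ_castSucc]
            simp [Fin.snoc_castSucc, Fin.snoc_last]
          rw [hsum]
          push_cast
          linarith

/-- **Lee–Raghavendra–Steurer 2015, Lemma 4.6 — complex Hermitian form, prior `Q_0 = U`.**
For a set `𝒯` of Hermitian tests with `−Δ·1 ⪯ A ⪯ Δ·1` (`Δ > 0`), a density matrix `Q` and `ε > 0`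
there are `h ≤ ⌈(8/ε²)·S(Q‖U)·Δ²⌉` tests `A_1, …, A_h ∈ 𝒯` (`S(Q‖U) = log dim − S(Q)`) such that the
density matrix `Q̃ = exp((ε/4Δ²) Σ_i A_i)/Tr exp((ε/4Δ²) Σ_i A_i)` satisfies `Re Tr(B(Q − Q̃)) ≤ ε` for
every `B ∈ 𝒯`; moreover `h ≤ (16/3)·S(Q‖U)·Δ²/ε²`.
[cite: LeeRaghavendraSteurer2015, Lemma 4.6 (p. 19–20)] -/
theorem sparse_approximation [Nonempty n] (𝒯 : Set (Matrix n n ℂ)) {Δ : ℝ} (hΔ : 0 < Δ)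
    (h𝒯 : ∀ A ∈ 𝒯, A.IsHermitian ∧ ((Δ : ℂ) • (1 : Matrix n n ℂ) - A).PosSemidef ∧
      ((Δ : ℂ) • (1 : Matrix n n ℂ) + A).PosSemidef)
    {Q : Matrix n n ℂ} (hQ : Q.PosSemidef) (hQ1 : Q.trace = 1) {ε : ℝ} (hε : 0 < ε) :
    ∃ (h : ℕ) (A : Fin h → Matrix n n ℂ),
      h ≤ ⌈8 / ε ^ 2 * (Real.log (Fintype.card n) -
        Literature.InformationTheory.Entropy.vonNeumannEntropy Q) * Δ ^ 2⌉₊ ∧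
      (∀ i, A i ∈ 𝒯) ∧
      (iterate (ε / (4 * Δ ^ 2)) (∑ i, A i)).PosSemidef ∧
      (iterate (ε / (4 * Δ ^ 2)) (∑ i, A i)).trace = 1 ∧
      (∀ B ∈ 𝒯, (B * (Q - iterate (ε / (4 * Δ ^ 2)) (∑ i, A i))).trace.re ≤ ε) ∧
      (h : ℝ) ≤ 16 / 3 * (Real.log (Fintype.card n) -
        Literature.InformationTheory.Entropy.vonNeumannEntropy Q) * Δ ^ 2 / ε ^ 2 := by
  set D := Real.log (Fintype.card n) - Literature.InformationTheory.Entropy.vonNeumannEntropy Q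
    with hD_def
  set i₀ := ⌈8 / ε ^ 2 * D * Δ ^ 2⌉₊ with hi₀_def
  obtain ⟨j, As, hji, hAs, hpot, hgood⟩ := iterate_descent hQ hQ1 hΔ hε h𝒯 i₀
  have hSh : (∑ l, As l).IsHermitian := isHermitian_sum fun l => (h𝒯 _ (hAs l)).1
  have hD0 : 0 ≤ D := by
    have h0 := potential_nonneg (Q := Q) Matrix.isHermitian_zero hQ hQ1 (ε / (4 * Δ ^ 2))
    rw [potential_zero] at h0
    exact h0
  have hΦ0 := potential_nonneg hSh hQ hQ1 (ε / (4 * Δ ^ 2))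
  have hκ : (0 : ℝ) < 3 * ε ^ 2 / (16 * Δ ^ 2) := by positivity
  have hjκ : (j : ℝ) * (3 * ε ^ 2 / (16 * Δ ^ 2)) ≤ D := by linarith
  have hjreal : (j : ℝ) ≤ 16 / 3 * D * Δ ^ 2 / ε ^ 2 := by
    rw [le_div_iff₀ (by positivity)]
    have : (j : ℝ) * (3 * ε ^ 2 / (16 * Δ ^ 2)) * (16 * Δ ^ 2) / 3 ≤ D * (16 * Δ ^ 2) / 3 := by
      gcongr
    have h16 : (j : ℝ) * (3 * ε ^ 2 / (16 * Δ ^ 2)) * (16 * Δ ^ 2) / 3 = j * ε ^ 2 := by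
      field_simp
    rw [h16] at this
    linarith
  refine ⟨j, As, ?_, hAs, posSemidef_iterate hSh _, trace_iterate hSh _, ?_, hjreal⟩
  · -- `j ≤ ⌈8 D Δ²/ε²⌉` from `j ≤ (16/3) D Δ²/ε² ≤ 8 D Δ²/ε²`
    have h1 : (j : ℝ) ≤ 8 / ε ^ 2 * D * Δ ^ 2 := by
      have e1 : 8 / ε ^ 2 * D * Δ ^ 2 = 8 * (D * Δ ^ 2 / ε ^ 2) := by ring
      have e2 : 16 / 3 * D * Δ ^ 2 / ε ^ 2 = 16 / 3 * (D * Δ ^ 2 / ε ^ 2) := by ring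
      have e3 : 0 ≤ D * Δ ^ 2 / ε ^ 2 := by positivity
      rw [e1]
      rw [e2] at hjreal
      linarith
    exact_mod_cast h1.trans (Nat.le_ceil _)
  · rcases hgood with hgood | hji'
    · exact hgood
    · -- `j = i₀` forced steps: then `Φ ≤ D − i₀κ`, and `i₀ κ ≥ (8DΔ²/ε²)(3ε²/16Δ²) = 3D/2`, so `Φ ≤ −D/2`,
      -- forcing `D = 0 = Φ`... but then a further distinguishing test would make Φ negative:
      by_contra hbad
      push Not at hbad
      obtain ⟨B, hB𝒯, hdist⟩ := hbad
      have hlt := potential_add_lt hQ hQ1 hSh (h𝒯 B hB𝒯).1 hΔ hε (h𝒯 B hB𝒯).2.1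
        (h𝒯 B hB𝒯).2.2 hdist
      have hΦ1 := potential_nonneg (hSh.add (h𝒯 B hB𝒯).1) hQ hQ1 (ε / (4 * Δ ^ 2))
      have hi₀ge : 8 / ε ^ 2 * D * Δ ^ 2 ≤ (i₀ : ℝ) := Nat.le_ceil _
      have hjcast : (j : ℝ) = i₀ := by exact_mod_cast hji'
      rw [hjcast] at hpot
      have h3 : (i₀ : ℝ) * (3 * ε ^ 2 / (16 * Δ ^ 2)) ≥ 8 / ε ^ 2 * D * Δ ^ 2 *
          (3 * ε ^ 2 / (16 * Δ ^ 2)) := by gcongr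
      have h4 : 8 / ε ^ 2 * D * Δ ^ 2 * (3 * ε ^ 2 / (16 * Δ ^ 2)) = 3 / 2 * D := by
        field_simp
        ring
      linarith

end Lemma46

/-! ### Lemma 4.6 in the vocabulary of `DensityMatrixApproximation.lean` (real symmetric matrices) -/

section Real

open Matrix hiding partitionFn gibbsWeight
open Complex (ofRealHom)

/-- **The prescribed approximator** `Q̃ = exp(η S)/Tr exp(η S)` of Lemma 4.6 for a real symmetric `S`
(the matrix exponential through the functional calculus of `S`; in Lemma 4.6, `S = Σ_i A_i` and
`η = ε/(4Δ(𝒯)²)`). [cite: LeeRaghavendraSteurer2015, Lemma 4.6 (p. 19, eq. (prescribed) with Q_0 = U)] -/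
def expState {r : ℕ} (η : ℝ) (S : Matrix (Fin r) (Fin r) ℝ) : Matrix (Fin r) (Fin r) ℝ :=
  ((cfc (fun x => Real.exp (η * x)) S).trace)⁻¹ • cfc (fun x => Real.exp (η * x)) S

/-- `Tr exp(ηS) > 0` (dimension `r ≥ 1`). [cite: LeeRaghavendraSteurer2015, Lemma 4.6 (p. 19: "Q̃ ∈ 𝒟(H)")] -/
theorem trace_cfc_exp_pos {r : ℕ} (hr : 0 < r) (η : ℝ) {S : Matrix (Fin r) (Fin r) ℝ}
    (hS : S.IsSymm) : 0 < (cfc (fun x => Real.exp (η * x)) S).trace := by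
  haveI : Nonempty (Fin r) := ⟨⟨0, hr⟩⟩
  rw [Literature.LinearAlgebra.Matrix.trace_cfc_eq_sum_eigenvalues (Lemma42.isHermitian_of_isSymm hS)]
  simp only [RCLike.ofReal_real_eq_id, id_eq]
  exact sum_pos (fun i _ => Real.exp_pos _) univ_nonempty

/-- The prescribed approximator is a density matrix. [cite: LeeRaghavendraSteurer2015, Lemma 4.6 (p. 19: "Q̃ ∈ 𝒟(H)")] -/
theorem isDensityMatrix_expState {r : ℕ} (hr : 0 < r) (η : ℝ) {S : Matrix (Fin r) (Fin r) ℝ}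
    (hS : S.IsSymm) : IsDensityMatrix (expState η S) := by
  have hpos := trace_cfc_exp_pos hr η hS
  refine ⟨?_, ?_⟩
  · exact (Literature.LinearAlgebra.Matrix.posSemidef_cfc_of_nonneg' S
      (fun x => (Real.exp_pos _).le)).smul (inv_nonneg.mpr hpos.le)
  · rw [expState, trace_smul, smul_eq_mul, inv_mul_cancel₀ hpos.ne']

/-- The inclusion `ℝ^{r×r} ⊂ ℂ^{r×r}` commutes with finite sums. [folklore] -/
private theorem map_ofReal_sum {m : Type*} {h : ℕ} (A : Fin h → Matrix m m ℝ) :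
    (∑ i, A i).map ofRealHom = ∑ i, (A i).map ofRealHom := by
  ext x y
  simp [Matrix.sum_apply]

/-- The complex iterate of the complexified tests is the complexified real approximator.
[cite: LeeRaghavendraSteurer2015, Lemma 4.6 (p. 19, eq. (prescribed))] -/
theorem iterate_map_ofReal {r : ℕ} (η : ℝ) {S : Matrix (Fin r) (Fin r) ℝ} (hS : S.IsSymm) :
    Lemma46.iterate η (S.map ofRealHom) = (expState η S).map ofRealHom := by
  have hW : Matrix.gibbsWeight (-η) (S.map ofRealHom) =
      (cfc (fun x => Real.exp (η * x)) S).map ofRealHom := by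
    rw [Lemma42.gibbsWeight_map_ofReal hS (-η)]
    congr 2
    funext x
    rw [neg_mul, neg_neg]
  rw [Lemma46.iterate, Matrix.partitionFn, hW, Lemma42.trace_map_ofReal, expState,
    Lemma42.map_ofReal_smul, Complex.ofReal_inv]

/-- **Lee–Raghavendra–Steurer 2015, Lemma 4.6 (sparse approximation by mirror descent; prior
`Q_0 = U`) — PROVED.**  "For every `ε > 0`, the following holds. Let `𝒯 ⊆ 𝓜(H)` be a compact set, and
let `Q ∈ 𝒟(H)` be a density matrix. If one defines `h = ⌈(8/ε²) S(Q‖U) Δ(𝒯)²⌉` then there exist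
`A_1, …, A_h ∈ 𝒯` such that `Q̃ = exp(log U + (ε/4Δ(𝒯)²) Σ_i A_i)/Tr(…) ∈ 𝒟(H)` satisfies
`[Q − Q̃]_𝒯 ≤ ε`", `[A]_𝒯 = sup_{B∈𝒯} Tr(BA)`.  Rendered for `H = ℝ^r`: tests are real symmetric
matrices with `−Δ·Id ⪯ A ⪯ Δ·Id` (this is `‖A‖ ≤ Δ`; any `Δ ≥ Δ(𝒯)`, `Δ > 0`), `IsDensityMatrix Q`,
`S(Q‖U) = relEntropy Q (uniformDensity r)`, the approximator `expState (ε/(4Δ²)) (Σ_i A_i)`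
(`log U` is scalar and cancels in the normalisation), "there exist `h = ⌈…⌉` elements" as
"`h ≤ ⌈…⌉` elements" (the printed proof stops at the first good iterate; pad with copies if an exact
count is wanted), and the sign of the exponent as in Cor. 4.7 (see the module docstring).  Compactness
is not needed.  [cite: LeeRaghavendraSteurer2015, Lemma 4.6 (p. 19–20)] -/
theorem LeeRaghavendraSteurer2015_lemma46 {r : ℕ} (𝒯 : Set (Matrix (Fin r) (Fin r) ℝ)) {Δ : ℝ}
    (hΔ : 0 < Δ) (h𝒯 : ∀ A ∈ 𝒯, A.IsSymm ∧ -(Δ • (1 : Matrix (Fin r) (Fin r) ℝ)) ≤ A ∧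
      A ≤ Δ • (1 : Matrix (Fin r) (Fin r) ℝ))
    {Q : Matrix (Fin r) (Fin r) ℝ} (hQ : IsDensityMatrix Q) {ε : ℝ} (hε : 0 < ε) :
    ∃ (h : ℕ) (A : Fin h → Matrix (Fin r) (Fin r) ℝ),
      h ≤ ⌈8 / ε ^ 2 * relEntropy Q (uniformDensity r) * Δ ^ 2⌉₊ ∧ (∀ i, A i ∈ 𝒯) ∧
      IsDensityMatrix (expState (ε / (4 * Δ ^ 2)) (∑ i, A i)) ∧
      (∀ B ∈ 𝒯, (B * (Q - expState (ε / (4 * Δ ^ 2)) (∑ i, A i))).trace ≤ ε) ∧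
      (h : ℝ) ≤ 16 / 3 * relEntropy Q (uniformDensity r) * Δ ^ 2 / ε ^ 2 := by
  -- dimension `r ≥ 1` (a density matrix has trace one)
  have hr : 0 < r := by
    rcases Nat.eq_zero_or_pos r with h | h
    · exfalso
      subst h
      have := hQ.2
      rw [Matrix.trace_fin_zero] at this
      exact zero_ne_one this
    · exact h
  haveI : Nonempty (Fin r) := ⟨⟨0, hr⟩⟩
  have hQsymm : Q.IsSymm := by
    have h := hQ.1.1.eq
    rwa [conjTranspose_eq_transpose_of_trivial] at h
  have hQ1 : (Q.map ofRealHom).trace = 1 := by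
    rw [Lemma42.trace_map_ofReal, hQ.2, Complex.ofReal_one]
  -- the complexified tests
  set 𝒯' : Set (Matrix (Fin r) (Fin r) ℂ) := (fun A => A.map ofRealHom) '' 𝒯 with h𝒯'_def
  have hone : (1 : Matrix (Fin r) (Fin r) ℝ).map ofRealHom = 1 :=
    Matrix.map_one _ (map_zero ofRealHom) (map_one ofRealHom)
  have h𝒯' : ∀ A' ∈ 𝒯', A'.IsHermitian ∧ ((Δ : ℂ) • (1 : Matrix (Fin r) (Fin r) ℂ) - A').PosSemidef ∧
      ((Δ : ℂ) • (1 : Matrix (Fin r) (Fin r) ℂ) + A').PosSemidef := by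
    rintro A' ⟨A, hA, rfl⟩
    obtain ⟨hAs, hAge, hAle⟩ := h𝒯 A hA
    refine ⟨Lemma42.isHermitian_map_ofReal hAs, ?_, ?_⟩
    · have h1 : (Δ • (1 : Matrix (Fin r) (Fin r) ℝ) - A).PosSemidef := Matrix.le_iff.mp hAle
      have h2 := Lemma42.posSemidef_map_ofReal h1
      rw [Matrix.map_sub _ (map_sub ofRealHom), Lemma42.map_ofReal_smul, hone] at h2
      exact h2
    · have h1 : (Δ • (1 : Matrix (Fin r) (Fin r) ℝ) + A).PosSemidef := by
        have := Matrix.le_iff.mp hAge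
        rwa [sub_neg_eq_add, add_comm] at this
      have h2 := Lemma42.posSemidef_map_ofReal h1
      rw [Matrix.map_add _ (map_add ofRealHom), Lemma42.map_ofReal_smul, hone] at h2
      exact h2
  obtain ⟨h, A', hh, hA', -, -, hgood, hhreal⟩ :=
    Lemma46.sparse_approximation 𝒯' hΔ h𝒯' (Lemma42.posSemidef_map_ofReal hQ.1) hQ1 hε
  -- pull the tests back to real matrices
  have hpre : ∀ i, ∃ A ∈ 𝒯, A.map ofRealHom = A' i := fun i => hA' i
  choose A hA𝒯 hAeq using hpre
  have hS : ∑ i, A' i = (∑ i, A i).map ofRealHom := by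
    rw [map_ofReal_sum]
    exact sum_congr rfl fun i _ => (hAeq i).symm
  have hSsymm : (∑ i, A i).IsSymm := by
    unfold Matrix.IsSymm
    rw [Matrix.transpose_sum]
    exact sum_congr rfl fun i _ => (h𝒯 _ (hA𝒯 i)).1
  have hent : Real.log (Fintype.card (Fin r)) -
      Literature.InformationTheory.Entropy.vonNeumannEntropy (Q.map ofRealHom) =
      relEntropy Q (uniformDensity r) := by
    rw [Fintype.card_fin, Lemma42.vonNeumannEntropy_map_ofReal hQsymm,
      relEntropy_uniformDensity hr hQ.2]
  rw [hent] at hh hhreal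
  refine ⟨h, A, hh, hA𝒯, isDensityMatrix_expState hr _ hSsymm, ?_, hhreal⟩
  intro B hB
  have hB' : B.map ofRealHom ∈ 𝒯' := ⟨B, hB, rfl⟩
  have h1 := hgood _ hB'
  rwa [hS, iterate_map_ofReal _ hSsymm, ← Matrix.map_sub _ (map_sub ofRealHom), ← Matrix.map_mul,
    Lemma42.trace_map_ofReal, Complex.ofReal_re] at h1

end Real

/-! ### Theorem 4.5: approximation by a low-degree square -/

namespace Thm45

open Matrix hiding partitionFn gibbsWeight
open Polynomial

/-- `Tr(B · U diag(d) Uᵀ) = Σ_k (Uᵀ B U)_{kk} d_k`. [folklore] -/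
private theorem trace_mul_conj_diagonal {r : ℕ} (B U : Matrix (Fin r) (Fin r) ℝ) (d : Fin r → ℝ) :
    (B * (U * diagonal d * star U)).trace = ∑ k, (star U * B * U) k k * d k := by
  have h1 : B * (U * diagonal d * star U) = (B * U * diagonal d) * star U := by
    simp only [Matrix.mul_assoc]
  rw [h1, trace_mul_comm, ← Matrix.mul_assoc, ← Matrix.mul_assoc]
  simp only [Matrix.trace, Matrix.diag_apply, Matrix.mul_diagonal]

/-- `Tr(B f(F)) = Σ_k (Uᵀ B U)_{kk} f(λ_k)` in an orthonormal eigenbasis `U` of the symmetric `F`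
("since `e^F` and `p(F)` are simultaneously diagonalizable").
[cite: LeeRaghavendraSteurer2015, Lemma 4.3 proof (p. 18)] -/
theorem trace_mul_cfc_eq_sum {r : ℕ} {F : Matrix (Fin r) (Fin r) ℝ} (hF : F.IsHermitian)
    (B : Matrix (Fin r) (Fin r) ℝ) (f : ℝ → ℝ) :
    (B * cfc f F).trace = ∑ k, (star (hF.eigenvectorUnitary : Matrix (Fin r) (Fin r) ℝ) * B *
      (hF.eigenvectorUnitary : Matrix (Fin r) (Fin r) ℝ)) k k * f (hF.eigenvalues k) := by
  rw [hF.cfc_eq, Matrix.IsHermitian.cfc, Unitary.conjStarAlgAut_apply]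
  rw [show (diagonal (RCLike.ofReal ∘ f ∘ hF.eigenvalues) : Matrix (Fin r) (Fin r) ℝ) =
      diagonal (fun k => f (hF.eigenvalues k)) from rfl, trace_mul_conj_diagonal]

/-- The diagonal of `Uᵀ B U` lies in `[−Δ, Δ]` for orthogonal `U` and `−Δ·Id ⪯ B ⪯ Δ·Id`.
[cite: LeeRaghavendraSteurer2015, §4.2 (p. 19, eq. (4.4): |[A]_𝒯| ≤ Δ(𝒯)‖A‖_*)] -/
theorem abs_conj_diag_le {r : ℕ} {B U : Matrix (Fin r) (Fin r) ℝ} (hU : U ∈ Matrix.unitaryGroup (Fin r) ℝ)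
    {Δ : ℝ} (hge : -(Δ • (1 : Matrix (Fin r) (Fin r) ℝ)) ≤ B) (hle : B ≤ Δ • (1 : Matrix (Fin r) (Fin r) ℝ))
    (k : Fin r) : |(star U * B * U) k k| ≤ Δ := by
  have hUU : star U * U = 1 := Matrix.mem_unitaryGroup_iff'.1 hU
  rw [abs_le]
  constructor
  · have hpsd : (B - -(Δ • (1 : Matrix (Fin r) (Fin r) ℝ))).PosSemidef := Matrix.le_iff.mp hge
    have h := (hpsd.conjTranspose_mul_mul_same U).diag_nonneg (i := k)
    rw [← star_eq_conjTranspose, sub_neg_eq_add, Matrix.mul_add, Matrix.add_mul, Matrix.mul_smul,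
      Matrix.mul_one, Matrix.smul_mul, hUU] at h
    simp only [Matrix.add_apply, Matrix.smul_apply, Matrix.one_apply_eq, smul_eq_mul, mul_one] at h
    linarith
  · have hpsd : (Δ • (1 : Matrix (Fin r) (Fin r) ℝ) - B).PosSemidef := Matrix.le_iff.mp hle
    have h := (hpsd.conjTranspose_mul_mul_same U).diag_nonneg (i := k)
    rw [← star_eq_conjTranspose, Matrix.mul_sub, Matrix.sub_mul, Matrix.mul_smul, Matrix.mul_one,
      Matrix.smul_mul, hUU] at h
    simp only [Matrix.sub_apply, Matrix.smul_apply, Matrix.one_apply_eq, smul_eq_mul, mul_one] at h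
    linarith

/-- `|Tr(B ρ)| ≤ Δ` for a density matrix `ρ` and `−Δ·Id ⪯ B ⪯ Δ·Id`.
[cite: LeeRaghavendraSteurer2015, §4.2 (p. 19, eq. (4.4))] -/
theorem abs_trace_mul_le {r : ℕ} {B ρ : Matrix (Fin r) (Fin r) ℝ} {Δ : ℝ}
    (hge : -(Δ • (1 : Matrix (Fin r) (Fin r) ℝ)) ≤ B) (hle : B ≤ Δ • (1 : Matrix (Fin r) (Fin r) ℝ))
    (hρ : IsDensityMatrix ρ) : |(B * ρ).trace| ≤ Δ := by
  rw [abs_le]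
  constructor
  · have hpsd : (B - -(Δ • (1 : Matrix (Fin r) (Fin r) ℝ))).PosSemidef := Matrix.le_iff.mp hge
    have h := Thm34.trace_mul_nonneg_of_posSemidef' hpsd hρ.1
    rw [sub_neg_eq_add, Matrix.add_mul, Matrix.smul_mul, Matrix.one_mul, trace_add, trace_smul,
      hρ.2, smul_eq_mul, mul_one] at h
    linarith
  · have hpsd : (Δ • (1 : Matrix (Fin r) (Fin r) ℝ) - B).PosSemidef := Matrix.le_iff.mp hle
    have h := Thm34.trace_mul_nonneg_of_posSemidef' hpsd hρ.1
    rw [Matrix.sub_mul, Matrix.smul_mul, Matrix.one_mul, trace_sub, trace_smul, hρ.2, smul_eq_mul,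
      mul_one] at h
    linarith

/-- The maximally mixed state as a square: `(r^{-1/2})² · Id = U`, trace one. [cite: LeeRaghavendraSteurer2015, proof of Thm 4.5 (p. 20: "Q̃_0 = U")] -/
theorem aeval_const_sq {r : ℕ} (hr : 0 < r) (F : Matrix (Fin r) (Fin r) ℝ) :
    aeval F (Polynomial.C (Real.sqrt r)⁻¹) * aeval F (Polynomial.C (Real.sqrt r)⁻¹) =
      uniformDensity r := by
  have hr' : (0 : ℝ) < r := by exact_mod_cast hr
  rw [Polynomial.aeval_C, Algebra.algebraMap_eq_smul_one, smul_mul_smul_comm, Matrix.one_mul,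
    uniformDensity, ← mul_inv, Real.mul_self_sqrt hr'.le, one_div]

end Thm45

section MainTheorem

open Matrix hiding partitionFn gibbsWeight
open Polynomial Thm45

/-- **Lee–Raghavendra–Steurer 2015, Theorem 4.5 (approximation by a low-degree square) — PROVED.**
"For every `ε ∈ (0, ½)`, the following holds. Let `𝒯 ⊆ 𝓜(H)` be compact and convex, and let
`Q ∈ 𝒟(H)` be a density matrix. Then there exists a number `k ≲ (1 + S(Q‖U))·Δ(𝒯)/ε`, a univariate
degree-`k` polynomial `p`, and an element `F ∈ 𝒯` such that `Tr(p(F)²) = 1` and `[Q − p(F)²]_𝒯 ≤ ε`."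
Rendered for `H = ℝ^r` (as `LeeRaghavendraSteurer2015_thm34`): `≲` = "`≤ C ·`" with the universal
`C = 100`; tests real symmetric with `−Δ·Id ⪯ A ⪯ Δ·Id` (`Δ > 0`, any `Δ ≥ Δ(𝒯)`); `𝒯` convex and
NONEMPTY (needed for "`F ∈ 𝒯`"; compactness is not used); `[Q − P]_𝒯 ≤ ε` as
`∀ B ∈ 𝒯, Tr(B(Q − P)) ≤ ε`; every `ε > 0` (the printed restriction `ε < ½` only serves the sharper
`log/log log` degree count of Cor. 4.4, replaced here by the cruder `Thm34.exp_taylor_relative`).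
Proof = the printed one (p. 20): Lemma 4.6 with `ε/2` and `Q_0 = U` gives `Q̃ = e^{λF}/Tr e^{λF}` with
`F = h⁻¹ Σ_i A_i ∈ 𝒯` (convexity) and `λ = hε/(8Δ²) ≤ (8/3) S(Q‖U)/ε`; the truncated exponential
series `q ≈ e^{λx/2}` with relative error `ε/(48Δ)` on `[−λΔ/2, λΔ/2]` (Cor. 4.4) gives
`P = q(F)²/Tr q(F)²` with `|Tr(B(Q̃ − P))| ≤ ε/2` for every test `B` (Lemma 4.3 eigenvalue-wise in an
eigenbasis of `F`, `Thm34.weightedAvg_sub_weightedAvg_le` with the weights `(UᵀBU)_{kk} ∈ [−Δ, Δ]`).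
[cite: LeeRaghavendraSteurer2015, Thm. 4.5 (p. 19) and its proof (p. 20)] -/
theorem LeeRaghavendraSteurer2015_thm45 : ∃ C : ℝ, 0 < C ∧
    ∀ (r : ℕ) (𝒯 : Set (Matrix (Fin r) (Fin r) ℝ)) (Δ : ℝ), 0 < Δ → Convex ℝ 𝒯 → 𝒯.Nonempty →
      (∀ A ∈ 𝒯, A.IsSymm ∧ -(Δ • (1 : Matrix (Fin r) (Fin r) ℝ)) ≤ A ∧
        A ≤ Δ • (1 : Matrix (Fin r) (Fin r) ℝ)) →
    ∀ Q : Matrix (Fin r) (Fin r) ℝ, IsDensityMatrix Q → ∀ ε : ℝ, 0 < ε →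
    ∃ (k : ℕ) (p : ℝ[X]) (F : Matrix (Fin r) (Fin r) ℝ), F ∈ 𝒯 ∧
      (k : ℝ) ≤ C * (1 + relEntropy Q (uniformDensity r)) * Δ / ε ∧ p.natDegree ≤ k ∧
      (aeval F p * aeval F p).trace = 1 ∧
      ∀ B ∈ 𝒯, (B * (Q - aeval F p * aeval F p)).trace ≤ ε := by
  refine ⟨100, by norm_num, ?_⟩
  intro r 𝒯 Δ hΔ hconv hne h𝒯 Q hQ ε hε
  have hr : 0 < r := by
    rcases Nat.eq_zero_or_pos r with h | h
    · exfalso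
      subst h
      have := hQ.2
      rw [Matrix.trace_fin_zero] at this
      exact zero_ne_one this
    · exact h
  have hr' : (0 : ℝ) < r := by exact_mod_cast hr
  haveI : Nonempty (Fin r) := ⟨⟨0, hr⟩⟩
  obtain ⟨F₀, hF₀⟩ := hne
  -- `S(Q‖U) ≥ 0`
  obtain ⟨S, hS_def⟩ : ∃ S : ℝ, S = relEntropy Q (uniformDensity r) := ⟨_, rfl⟩
  have hS0 : 0 ≤ S := by
    have hQsymm : Q.IsSymm := by
      have h := hQ.1.1.eq
      rwa [conjTranspose_eq_transpose_of_trivial] at h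
    have hQc := Lemma42.posSemidef_map_ofReal hQ.1
    have hQc1 : (Q.map Complex.ofRealHom).trace = 1 := by
      rw [Lemma42.trace_map_ofReal, hQ.2, Complex.ofReal_one]
    have hv := Lemma46.potential_nonneg (Q := Q.map Complex.ofRealHom) Matrix.isHermitian_zero hQc
      hQc1 0
    rw [Lemma46.potential_zero, Fintype.card_fin, Lemma42.vonNeumannEntropy_map_ofReal hQsymm,
      ← relEntropy_uniformDensity hr hQ.2, ← hS_def] at hv
    exact hv
  rw [← hS_def]
  -- the trivial regime `ε ≥ 2Δ`: `P = U`
  have htriv : ∀ B ∈ 𝒯, ∀ P : Matrix (Fin r) (Fin r) ℝ, IsDensityMatrix P →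
      (B * (Q - P)).trace ≤ 2 * Δ := by
    intro B hB P hP
    obtain ⟨-, hBge, hBle⟩ := h𝒯 B hB
    rw [Matrix.mul_sub, trace_sub]
    have h1 := (abs_le.mp (abs_trace_mul_le hBge hBle hQ)).2
    have h2 := (abs_le.mp (abs_trace_mul_le hBge hBle hP)).1
    linarith
  by_cases hεΔ : 2 * Δ ≤ ε
  · refine ⟨0, Polynomial.C (Real.sqrt r)⁻¹, F₀, hF₀, by push_cast; positivity,
      (natDegree_C _).le, ?_, ?_⟩
    · rw [aeval_const_sq hr, (isDensityMatrix_uniformDensity hr).2]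
    · intro B hB
      rw [aeval_const_sq hr]
      exact (htriv B hB _ (isDensityMatrix_uniformDensity hr)).trans hεΔ
  have hεΔ' : ε < 2 * Δ := not_le.mp hεΔ
  -- Lemma 4.6 with `ε/2`
  obtain ⟨h, A, -, hA, hdens, hgood, hhle⟩ :=
    LeeRaghavendraSteurer2015_lemma46 𝒯 hΔ h𝒯 hQ (half_pos hε)
  rw [← hS_def] at hhle
  set η : ℝ := ε / 2 / (4 * Δ ^ 2) with hη_def
  by_cases hh0 : h = 0
  · -- no step was needed: `Q̃ = U`
    subst hh0
    have hsum : (∑ i : Fin 0, A i) = 0 := by simp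
    have hU : expState η (∑ i : Fin 0, A i) = uniformDensity r := by
      rw [hsum, expState]
      have h0 : cfc (fun x => Real.exp (η * x)) (0 : Matrix (Fin r) (Fin r) ℝ) = 1 := by
        rw [show (0 : Matrix (Fin r) (Fin r) ℝ) = algebraMap ℝ _ 0 from (map_zero _).symm,
          cfc_algebraMap, mul_zero, Real.exp_zero, map_one]
      rw [h0, trace_one, Fintype.card_fin, uniformDensity, one_div]
    refine ⟨0, Polynomial.C (Real.sqrt r)⁻¹, F₀, hF₀, by push_cast; positivity,
      (natDegree_C _).le, ?_, ?_⟩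
    · rw [aeval_const_sq hr, (isDensityMatrix_uniformDensity hr).2]
    · intro B hB
      rw [aeval_const_sq hr, ← hU]
      exact (hgood B hB).trans (by linarith)
  -- `h ≥ 1`: `F = h⁻¹ Σ A_i ∈ 𝒯`, `λ = hη`
  have hhpos : 0 < h := Nat.pos_of_ne_zero hh0
  have hhr : (0 : ℝ) < h := by exact_mod_cast hhpos
  set F : Matrix (Fin r) (Fin r) ℝ := (h : ℝ)⁻¹ • ∑ i, A i with hF_def
  have hF𝒯 : F ∈ 𝒯 := by
    rw [hF_def, smul_sum]
    exact hconv.sum_mem (fun _ _ => by positivity) (by simp [hhr.ne']) fun i _ => hA i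
  obtain ⟨hFs, hFge, hFle⟩ := h𝒯 F hF𝒯
  have hFh : F.IsHermitian := Lemma42.isHermitian_of_isSymm hFs
  have hsumF : ∑ i, A i = (h : ℝ) • F := by
    rw [hF_def, smul_smul, mul_inv_cancel₀ hhr.ne', one_smul]
  set lam : ℝ := h * η with hlam_def
  have hlam0 : 0 < lam := by positivity
  -- eigenvalues of `F` in `[−Δ, Δ]`
  have hμle : ∀ i, hFh.eigenvalues i ≤ Δ := Thm31.eigenvalues_le_of_le_smul_one hFh hFle
  have hμge : ∀ i, -Δ ≤ hFh.eigenvalues i := fun i =>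
    Thm34.le_eigenvalues_of_smul_one_le hFh (by rw [neg_smul]; exact hFge) i
  have hμ : ∀ i, |hFh.eigenvalues i| ≤ Δ := fun i => abs_le.2 ⟨hμge i, hμle i⟩
  -- `Q̃ = e^{λF}/Tr e^{λF}`
  obtain ⟨W, hW⟩ : ∃ W : Matrix (Fin r) (Fin r) ℝ, W = cfc (fun x => Real.exp (lam * x)) F :=
    ⟨_, rfl⟩
  have hW' : cfc (fun x => Real.exp (η * x)) (∑ i, A i) = W := by
    rw [hsumF, hW, ← cfc_comp_smul (h : ℝ) (fun x => Real.exp (η * x)) F]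
    congr 1
    funext x
    simp only [smul_eq_mul, hlam_def]
    ring_nf
  have hQt : expState η (∑ i, A i) = (W.trace)⁻¹ • W := by rw [expState, hW']
  -- the Taylor polynomial (Cor 4.4) with relative error `η_T = ε/(48Δ)` on `[−λΔ/2, λΔ/2]`
  obtain ⟨a, ha_def⟩ : ∃ a : ℝ, a = lam * Δ / 2 := ⟨_, rfl⟩
  have ha0 : 0 ≤ a := by rw [ha_def]; positivity
  obtain ⟨ηT, hηT_def⟩ : ∃ t : ℝ, t = ε / (48 * Δ) := ⟨_, rfl⟩
  have hηT0 : 0 < ηT := by rw [hηT_def]; positivity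
  have hηT1 : ηT ≤ 1 := by rw [hηT_def, div_le_one (by positivity)]; linarith
  have h3η : 3 * ηT ≤ 3 / 4 := by
    rw [hηT_def]
    have : ε / (48 * Δ) ≤ 1 / 4 := by
      rw [div_le_div_iff₀ (by positivity) (by norm_num)]; linarith
    linarith
  obtain ⟨n, hn, hT⟩ := Thm34.exp_taylor_relative ha0 hηT0 hηT1
  obtain ⟨P, hP⟩ : ∃ P : ℝ[X], P = ∑ m ∈ range n, Polynomial.C ((m.factorial : ℝ)⁻¹) * X ^ m :=
    ⟨_, rfl⟩
  obtain ⟨q, hq⟩ : ∃ q : ℝ[X], q = P.comp (Polynomial.C (lam / 2) * X) := ⟨_, rfl⟩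
  have hqeval : ∀ x, q.eval x = ∑ m ∈ range n, (lam / 2 * x) ^ m / m.factorial := by
    intro x
    rw [hq, eval_comp, eval_mul, eval_C, eval_X, hP, eval_finsetSum]
    refine sum_congr rfl fun m _ => ?_
    rw [eval_mul, eval_C, eval_pow, eval_X]
    ring
  have hqdeg : q.natDegree ≤ n := by
    rw [hq]
    refine natDegree_comp_le.trans ?_
    have h1 : P.natDegree ≤ n := by
      rw [hP]
      refine natDegree_sum_le_of_forall_le _ _ fun m hm => ?_
      exact (natDegree_C_mul_X_pow_le _ _).trans (mem_range.1 hm).le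
    have h2 : (Polynomial.C (lam / 2) * X : ℝ[X]).natDegree ≤ 1 :=
      (natDegree_C_mul_le _ _).trans natDegree_X_le
    calc P.natDegree * (Polynomial.C (lam / 2) * X : ℝ[X]).natDegree ≤ n * 1 :=
          Nat.mul_le_mul h1 h2
      _ = n := mul_one n
  -- eigenvalue-wise comparison of `q(F)²` with `e^{λF}`
  have hqi : ∀ i, |q.eval (hFh.eigenvalues i) - Real.exp (lam / 2 * hFh.eigenvalues i)| ≤
      ηT * Real.exp (lam / 2 * hFh.eigenvalues i) := by
    intro i
    rw [hqeval]
    have hy : |lam / 2 * hFh.eigenvalues i| ≤ a := by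
      rw [abs_mul, abs_of_pos (by positivity : 0 < lam / 2), ha_def]
      calc lam / 2 * |hFh.eigenvalues i| ≤ lam / 2 * Δ :=
            mul_le_mul_of_nonneg_left (hμ i) (by positivity)
        _ = lam * Δ / 2 := by ring
    have := hT (lam / 2 * hFh.eigenvalues i) hy
    rw [abs_sub_comm] at this
    exact this
  have hgh : ∀ i, |q.eval (hFh.eigenvalues i) * q.eval (hFh.eigenvalues i) -
      Real.exp (lam * hFh.eigenvalues i)| ≤ 3 * ηT * Real.exp (lam * hFh.eigenvalues i) := by
    intro i
    have hs : Real.exp (lam * hFh.eigenvalues i) = Real.exp (lam / 2 * hFh.eigenvalues i) ^ 2 := by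
      rw [← Real.exp_nat_mul]; ring_nf
    rw [hs, ← pow_two]
    exact Thm34.sq_sub_sq_le_of_rel (Real.exp_pos _).le hηT0.le hηT1 (hqi i)
  -- `G = Tr q(F)² > 0`; the normalised polynomial `p = G^{-1/2} q`
  set G : ℝ := ∑ i, q.eval (hFh.eigenvalues i) * q.eval (hFh.eigenvalues i) with hG_def
  have ht1 : (aeval F q * aeval F q).trace = G := by
    rw [Thm34.aeval_mul_aeval_eq_cfc hFh, Thm34.trace_cfc_eq_sum hFh]
  set U : Matrix (Fin r) (Fin r) ℝ := (hFh.eigenvectorUnitary : Matrix (Fin r) (Fin r) ℝ) with hU_def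
  have hGpos : 0 < G := (Thm34.weightedAvg_sub_weightedAvg_le hFh.eigenvalues
    (fun i => q.eval (hFh.eigenvalues i) * q.eval (hFh.eigenvalues i))
    (fun i => Real.exp (lam * hFh.eigenvalues i)) hμ (fun i => Real.exp_pos _) hgh
    (by positivity) h3η).1
  set p : ℝ[X] := Polynomial.C (Real.sqrt G)⁻¹ * q with hp_def
  have hpF : aeval F p * aeval F p = G⁻¹ • (aeval F q * aeval F q) := by
    rw [hp_def, map_mul, Polynomial.aeval_C, Algebra.algebraMap_eq_smul_one, smul_mul_assoc,
      Matrix.one_mul, smul_mul_smul_comm, ← mul_inv, Real.mul_self_sqrt hGpos.le]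
  have hpdeg : p.natDegree ≤ n := by
    rw [hp_def]
    exact (natDegree_C_mul_le _ _).trans hqdeg
  refine ⟨n, p, F, hF𝒯, ?_, hpdeg, ?_, ?_⟩
  · -- degree count: `n ≤ 9a + log(2/η_T) + 2 ≤ 100 (1 + S) Δ/ε`
    have hlamle : lam ≤ 8 / 3 * S / ε := by
      rw [hlam_def, hη_def]
      have : (h : ℝ) * (ε / 2 / (4 * Δ ^ 2)) = h * ε / (8 * Δ ^ 2) := by ring
      rw [this, div_le_iff₀ (by positivity)]
      have h1 : (h : ℝ) * ε ≤ 16 / 3 * S * Δ ^ 2 / (ε / 2) ^ 2 * ε :=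
        mul_le_mul_of_nonneg_right hhle hε.le
      have h2 : 16 / 3 * S * Δ ^ 2 / (ε / 2) ^ 2 * ε = 8 / 3 * S / ε * (8 * Δ ^ 2) := by
        field_simp
        ring
      linarith
    have hale : a ≤ 4 / 3 * S * Δ / ε := by
      rw [ha_def]
      have := mul_le_mul_of_nonneg_right hlamle hΔ.le
      have e : 8 / 3 * S / ε * Δ = 2 * (4 / 3 * S * Δ / ε) := by ring
      linarith
    have hΔε : 1 / 2 < Δ / ε := by rw [lt_div_iff₀ hε]; linarith
    have h2 : Real.log (2 / ηT) ≤ 96 * (Δ / ε) := by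
      have he : 2 / ηT = 96 * (Δ / ε) := by rw [hηT_def]; field_simp; ring
      rw [he]
      have hx : 0 < 96 * (Δ / ε) := by positivity
      linarith [Real.log_le_sub_one_of_pos hx]
    have hSΔε : 0 ≤ S * Δ / ε := by positivity
    calc (n : ℝ) ≤ 9 * a + Real.log (2 / ηT) + 2 := hn
      _ ≤ 12 * (S * Δ / ε) + 96 * (Δ / ε) + 4 * (Δ / ε) := by
          have : 9 * a ≤ 12 * (S * Δ / ε) := by
            have e : 4 / 3 * S * Δ / ε = 4 / 3 * (S * Δ / ε) := by ring
            linarith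
          linarith
      _ = (12 * S + 100) * Δ / ε := by ring
      _ ≤ 100 * (1 + S) * Δ / ε := by
          rw [div_le_div_iff_of_pos_right hε]
          nlinarith
  · rw [hpF, trace_smul, ht1, smul_eq_mul, inv_mul_cancel₀ hGpos.ne']
  · intro B hB
    obtain ⟨-, hBge, hBle⟩ := h𝒯 B hB
    -- `Tr(B(Q − P)) = Tr(B(Q − Q̃)) + Tr(B(Q̃ − P))`
    have hsplit : (B * (Q - aeval F p * aeval F p)).trace =
        (B * (Q - expState η (∑ i, A i))).trace +
          ((B * expState η (∑ i, A i)).trace - (B * (aeval F p * aeval F p)).trace) := by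
      rw [Matrix.mul_sub, Matrix.mul_sub, trace_sub, trace_sub]
      ring
    rw [hsplit]
    have h46 := hgood B hB
    -- both `Q̃` and `P` are functions of `F`: weighted averages of `(UᵀBU)_{kk}`
    set μ : Fin r → ℝ := fun k => (star U * B * U) k k with hμ_def
    have hμB : ∀ k, |μ k| ≤ Δ := fun k => abs_conj_diag_le hFh.eigenvectorUnitary.2 hBge hBle k
    have htP : (B * (aeval F p * aeval F p)).trace =
        (∑ k, μ k * (q.eval (hFh.eigenvalues k) * q.eval (hFh.eigenvalues k))) / G := by
      rw [hpF, Matrix.mul_smul, trace_smul, smul_eq_mul, Thm34.aeval_mul_aeval_eq_cfc hFh,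
        trace_mul_cfc_eq_sum hFh, div_eq_inv_mul]
    have htQ : (B * expState η (∑ i, A i)).trace =
        (∑ k, μ k * Real.exp (lam * hFh.eigenvalues k)) /
          (∑ k, Real.exp (lam * hFh.eigenvalues k)) := by
      rw [hQt, Matrix.mul_smul, trace_smul, smul_eq_mul, hW, trace_mul_cfc_eq_sum hFh,
        Thm34.trace_cfc_eq_sum hFh, div_eq_inv_mul]
    obtain ⟨-, hdiff⟩ := Thm34.weightedAvg_sub_weightedAvg_le μ
      (fun i => q.eval (hFh.eigenvalues i) * q.eval (hFh.eigenvalues i))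
      (fun i => Real.exp (lam * hFh.eigenvalues i)) hμB (fun i => Real.exp_pos _) hgh
      (by positivity) h3η
    have h24 : 8 * Δ * (3 * ηT) = ε / 2 := by rw [hηT_def]; field_simp; ring
    rw [htP, htQ]
    have := (abs_le.1 hdiff).1
    linarith

end MainTheorem

/-! ### Lemma 4.6 with a general (positive definite) prior `Q_0`; Klein's inequality -/

namespace Lemma46

open Matrix hiding partitionFn gibbsWeight
open Literature.MathematicalPhysics.QuantumLattice
open Literature.InformationTheory.Entropy (quantumRelEntropy)

variable {n : Type*} [Fintype n] [DecidableEq n]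

/-- The descent run for `i` rounds from an ARBITRARY Hermitian starting exponent `S₀` (for the prior
`Q_0` of Lemma 4.6 take `S₀ = η⁻¹ log Q_0`): either a good iterate was reached after `j ≤ i` steps, or
`i` forced steps were taken; in both cases `Φ(S₀ + Σ A_l) ≤ Φ(S₀) − j·3ε²/(16Δ²)`.
[cite: LeeRaghavendraSteurer2015, proof of Lemma 4.6 (p. 20: "Q_t = exp(log Q_0 − ∫Λ_s)/Tr(…)")] -/
theorem iterate_descent_from [Nonempty n] {Q : Matrix n n ℂ} (hQ : Q.PosSemidef) (hQ1 : Q.trace = 1)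
    {𝒯 : Set (Matrix n n ℂ)} {Δ ε : ℝ} (hΔ : 0 < Δ) (hε : 0 < ε)
    (h𝒯 : ∀ A ∈ 𝒯, A.IsHermitian ∧ ((Δ : ℂ) • (1 : Matrix n n ℂ) - A).PosSemidef ∧
      ((Δ : ℂ) • (1 : Matrix n n ℂ) + A).PosSemidef) {S₀ : Matrix n n ℂ} (hS₀ : S₀.IsHermitian)
    (i : ℕ) :
    ∃ (j : ℕ) (As : Fin j → Matrix n n ℂ), j ≤ i ∧ (∀ l, As l ∈ 𝒯) ∧
      potential Q (ε / (4 * Δ ^ 2)) (S₀ + ∑ l, As l) ≤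
        potential Q (ε / (4 * Δ ^ 2)) S₀ - j * (3 * ε ^ 2 / (16 * Δ ^ 2)) ∧
      ((∀ B ∈ 𝒯, (B * (Q - iterate (ε / (4 * Δ ^ 2)) (S₀ + ∑ l, As l))).trace.re ≤ ε) ∨
        j = i) := by
  induction i with
  | zero =>
    refine ⟨0, Fin.elim0, le_rfl, fun l => l.elim0, ?_, Or.inr rfl⟩
    simp only [univ_eq_empty, sum_empty, Nat.cast_zero, zero_mul, sub_zero, add_zero, le_refl]
  | succ i ih =>
    obtain ⟨j, As, hji, hAs, hpot, hgood⟩ := ih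
    rcases hgood with hgood | hji'
    · exact ⟨j, As, hji.trans (Nat.le_succ i), hAs, hpot, Or.inl hgood⟩
    · by_cases hG : ∀ B ∈ 𝒯,
          (B * (Q - iterate (ε / (4 * Δ ^ 2)) (S₀ + ∑ l, As l))).trace.re ≤ ε
      · exact ⟨j, As, hji.trans (Nat.le_succ i), hAs, hpot, Or.inl hG⟩
      · push Not at hG
        obtain ⟨A, hA𝒯, hdist⟩ := hG
        have hSh : (S₀ + ∑ l, As l).IsHermitian :=
          hS₀.add (isHermitian_sum fun l => (h𝒯 _ (hAs l)).1)
        have hlt := potential_add_lt hQ hQ1 hSh (h𝒯 A hA𝒯).1 hΔ hε (h𝒯 A hA𝒯).2.1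
          (h𝒯 A hA𝒯).2.2 hdist
        refine ⟨j + 1, Fin.snoc As A, by omega, ?_, ?_, Or.inr (by omega)⟩
        · intro l
          refine Fin.lastCases ?_ (fun l => ?_) l
          · simpa using hA𝒯
          · simpa using hAs l
        · have hsum : (∑ l : Fin (j + 1), (Fin.snoc As A : Fin (j + 1) → Matrix n n ℂ) l) =
              (∑ l, As l) + A := by
            rw [Fin.sum_univ_castSucc]
            simp [Fin.snoc_castSucc, Fin.snoc_last]
          rw [hsum, ← add_assoc]
          push_cast
          linarith

/-- **The descent from an arbitrary starting exponent** (Lemma 4.6 with the prior entering through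
`S₀`): `h ≤ ⌈(8/ε²) Φ(S₀) Δ²⌉` tests make `Q̃ = e^{η(S₀ + Σ A_i)}/Tr(…)` indistinguishable from `Q`,
and `h ≤ (16/3) Φ(S₀) Δ²/ε²`. [cite: LeeRaghavendraSteurer2015, Lemma 4.6 (p. 19–20)] -/
theorem sparse_approximation_from [Nonempty n] (𝒯 : Set (Matrix n n ℂ)) {Δ : ℝ} (hΔ : 0 < Δ)
    (h𝒯 : ∀ A ∈ 𝒯, A.IsHermitian ∧ ((Δ : ℂ) • (1 : Matrix n n ℂ) - A).PosSemidef ∧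
      ((Δ : ℂ) • (1 : Matrix n n ℂ) + A).PosSemidef)
    {Q : Matrix n n ℂ} (hQ : Q.PosSemidef) (hQ1 : Q.trace = 1) {ε : ℝ} (hε : 0 < ε)
    {S₀ : Matrix n n ℂ} (hS₀ : S₀.IsHermitian) :
    ∃ (h : ℕ) (A : Fin h → Matrix n n ℂ),
      h ≤ ⌈8 / ε ^ 2 * potential Q (ε / (4 * Δ ^ 2)) S₀ * Δ ^ 2⌉₊ ∧
      (∀ i, A i ∈ 𝒯) ∧
      (iterate (ε / (4 * Δ ^ 2)) (S₀ + ∑ i, A i)).PosSemidef ∧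
      (iterate (ε / (4 * Δ ^ 2)) (S₀ + ∑ i, A i)).trace = 1 ∧
      (∀ B ∈ 𝒯, (B * (Q - iterate (ε / (4 * Δ ^ 2)) (S₀ + ∑ i, A i))).trace.re ≤ ε) ∧
      (h : ℝ) ≤ 16 / 3 * potential Q (ε / (4 * Δ ^ 2)) S₀ * Δ ^ 2 / ε ^ 2 := by
  set D := potential Q (ε / (4 * Δ ^ 2)) S₀ with hD_def
  set i₀ := ⌈8 / ε ^ 2 * D * Δ ^ 2⌉₊ with hi₀_def
  obtain ⟨j, As, hji, hAs, hpot, hgood⟩ := iterate_descent_from hQ hQ1 hΔ hε h𝒯 hS₀ i₀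
  have hSh : (S₀ + ∑ l, As l).IsHermitian :=
    hS₀.add (isHermitian_sum fun l => (h𝒯 _ (hAs l)).1)
  have hD0 : 0 ≤ D := potential_nonneg hS₀ hQ hQ1 _
  have hΦ0 := potential_nonneg hSh hQ hQ1 (ε / (4 * Δ ^ 2))
  have hκ : (0 : ℝ) < 3 * ε ^ 2 / (16 * Δ ^ 2) := by positivity
  have hjκ : (j : ℝ) * (3 * ε ^ 2 / (16 * Δ ^ 2)) ≤ D := by linarith
  have hjreal : (j : ℝ) ≤ 16 / 3 * D * Δ ^ 2 / ε ^ 2 := by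
    rw [le_div_iff₀ (by positivity)]
    have : (j : ℝ) * (3 * ε ^ 2 / (16 * Δ ^ 2)) * (16 * Δ ^ 2) / 3 ≤ D * (16 * Δ ^ 2) / 3 := by
      gcongr
    have h16 : (j : ℝ) * (3 * ε ^ 2 / (16 * Δ ^ 2)) * (16 * Δ ^ 2) / 3 = j * ε ^ 2 := by
      field_simp
    rw [h16] at this
    linarith
  refine ⟨j, As, ?_, hAs, posSemidef_iterate hSh _, trace_iterate hSh _, ?_, hjreal⟩
  · have h1 : (j : ℝ) ≤ 8 / ε ^ 2 * D * Δ ^ 2 := by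
      have e1 : 8 / ε ^ 2 * D * Δ ^ 2 = 8 * (D * Δ ^ 2 / ε ^ 2) := by ring
      have e2 : 16 / 3 * D * Δ ^ 2 / ε ^ 2 = 16 / 3 * (D * Δ ^ 2 / ε ^ 2) := by ring
      have e3 : 0 ≤ D * Δ ^ 2 / ε ^ 2 := by positivity
      rw [e1]
      rw [e2] at hjreal
      linarith
    exact_mod_cast h1.trans (Nat.le_ceil _)
  · rcases hgood with hgood | hji'
    · exact hgood
    · by_contra hbad
      push Not at hbad
      obtain ⟨B, hB𝒯, hdist⟩ := hbad
      have hlt := potential_add_lt hQ hQ1 hSh (h𝒯 B hB𝒯).1 hΔ hε (h𝒯 B hB𝒯).2.1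
        (h𝒯 B hB𝒯).2.2 hdist
      have hΦ1 := potential_nonneg (hSh.add (h𝒯 B hB𝒯).1) hQ hQ1 (ε / (4 * Δ ^ 2))
      have hi₀ge : 8 / ε ^ 2 * D * Δ ^ 2 ≤ (i₀ : ℝ) := Nat.le_ceil _
      have hjcast : (j : ℝ) = i₀ := by exact_mod_cast hji'
      rw [hjcast] at hpot
      have h3 : (i₀ : ℝ) * (3 * ε ^ 2 / (16 * Δ ^ 2)) ≥ 8 / ε ^ 2 * D * Δ ^ 2 *
          (3 * ε ^ 2 / (16 * Δ ^ 2)) := by gcongr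
      have h4 : 8 / ε ^ 2 * D * Δ ^ 2 * (3 * ε ^ 2 / (16 * Δ ^ 2)) = 3 / 2 * D := by
        field_simp
        ring
      linarith

/-- `exp(log Q_0) = Q_0` for a positive definite `Q_0` (Mathlib's `CFC.exp_log`). [folklore] -/
private theorem exp_cfc_log {Q₀ : Matrix n n ℂ} (hQ₀ : Q₀.PosDef) :
    NormedSpace.exp (cfc Real.log Q₀) = Q₀ :=
  CFC.exp_log Q₀ hQ₀.isStrictlyPositive

/-- `S(Q) = −Re Tr(Q log Q)` for Hermitian `Q` (`log` through the functional calculus). [folklore] -/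
private theorem vonNeumannEntropy_eq_neg_re_trace_mul_log {Q : Matrix n n ℂ} (hQ : Q.IsHermitian) :
    Literature.InformationTheory.Entropy.vonNeumannEntropy Q = -(Q * cfc Real.log Q).trace.re := by
  have hQ' : IsSelfAdjoint Q := hQ.isSelfAdjoint
  rw [Literature.InformationTheory.Entropy.vonNeumannEntropy_eq_re_trace_cfc_negMulLog hQ,
    Real.negMulLog_eq_neg, cfc_neg, cfc_mul (fun x : ℝ => x) Real.log Q
      (Literature.LinearAlgebra.Matrix.cfc_continuousOn Q _)
      (Literature.LinearAlgebra.Matrix.cfc_continuousOn Q _), cfc_id' ℝ Q, trace_neg,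
    Complex.neg_re]

/-- With the starting exponent `S₀ = η⁻¹ log Q_0` the Gibbs weight of the descent is the printed
`exp(log Q_0 + η S)`. [cite: LeeRaghavendraSteurer2015, Lemma 4.6 (p. 19, eq. (prescribed))] -/
theorem gibbsWeight_prior {η : ℝ} (hη : η ≠ 0) (Q₀ S : Matrix n n ℂ) :
    Matrix.gibbsWeight (-η) ((η : ℂ)⁻¹ • cfc Real.log Q₀ + S) =
      NormedSpace.exp (cfc Real.log Q₀ + (η : ℂ) • S) := by
  have hη' : (η : ℂ) ≠ 0 := Complex.ofReal_ne_zero.mpr hη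
  rw [Matrix.gibbsWeight, smul_add, smul_smul]
  push_cast
  rw [neg_neg, mul_inv_cancel₀ hη', one_smul]

/-- **The potential at the prior is the relative entropy**: `Φ(η⁻¹ log Q_0) = S(Q‖Q_0)` for a density
matrix `Q` and a positive definite density matrix `Q_0` (`Tr e^{log Q_0} = Tr Q_0 = 1`,
`S(Q) = −Tr Q log Q`). [cite: LeeRaghavendraSteurer2015, proof of Lemma 4.6 (p. 20: "T = (2/ε) S(Q‖Q_0)")] -/
theorem potential_prior [Nonempty n] {Q Q₀ : Matrix n n ℂ} (hQ : Q.PosSemidef) (hQ₀ : Q₀.PosDef)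
    (hQ₀1 : Q₀.trace = 1) {η : ℝ} (hη : η ≠ 0) :
    potential Q η ((η : ℂ)⁻¹ • cfc Real.log Q₀) = quantumRelEntropy Q Q₀ := by
  have hη' : (η : ℂ) ≠ 0 := Complex.ofReal_ne_zero.mpr hη
  have hZ : Matrix.partitionFn (-η) ((η : ℂ)⁻¹ • cfc Real.log Q₀) = 1 := by
    have h := gibbsWeight_prior hη Q₀ (0 : Matrix n n ℂ)
    rw [smul_zero, add_zero, add_zero, exp_cfc_log hQ₀] at h
    rw [Matrix.partitionFn, h, hQ₀1]
  have htr : η * (Q * ((η : ℂ)⁻¹ • cfc Real.log Q₀)).trace.re = (Q * cfc Real.log Q₀).trace.re := by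
    rw [Matrix.mul_smul, trace_smul, smul_eq_mul, ← Complex.ofReal_inv, Complex.re_ofReal_mul,
      ← mul_assoc, mul_inv_cancel₀ hη, one_mul]
  rw [potential, hZ, Complex.one_re, Real.log_one, zero_sub, htr,
    vonNeumannEntropy_eq_neg_re_trace_mul_log hQ.1, quantumRelEntropy, Matrix.mul_sub, trace_sub,
    Complex.sub_re]
  ring

/-- **Klein's inequality** `S(Q‖Q_0) ≥ 0` for a density matrix `Q` and a positive definite density
matrix `Q_0` — here a COROLLARY of the Gibbs variational principle (`potential_nonneg` at the prior:
`S(Q‖Q_0) = −S(Q) − Tr(Q log Q_0) + log Tr e^{log Q_0} ≥ 0`); it is the fact "`S(Q‖Q_T) ≥ 0`" on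
which the printed proof of Lemma 4.6 rests. [cite: LeeRaghavendraSteurer2015, proof of Lemma 4.6 (p. 20: "contradicts the fact that S(Q‖Q_T) ≥ 0")]
[cite: NielsenChuang2010, §11.3 Theorem 11.7 (Klein's inequality)] -/
theorem quantumRelEntropy_nonneg [Nonempty n] {Q Q₀ : Matrix n n ℂ} (hQ : Q.PosSemidef)
    (hQ1 : Q.trace = 1) (hQ₀ : Q₀.PosDef) (hQ₀1 : Q₀.trace = 1) : 0 ≤ quantumRelEntropy Q Q₀ := by
  have hL : (((1 : ℝ) : ℂ)⁻¹ • cfc Real.log Q₀ : Matrix n n ℂ).IsHermitian := by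
    rw [Complex.ofReal_one, inv_one, one_smul]
    exact Literature.LinearAlgebra.Matrix.isHermitian_cfc Q₀ Real.log
  rw [← potential_prior hQ hQ₀ hQ₀1 one_ne_zero]
  exact potential_nonneg hL hQ hQ1 1

/-- **Lee–Raghavendra–Steurer 2015, Lemma 4.6 — complex Hermitian form with a positive definite prior
`Q_0`.**  For tests `−Δ·1 ⪯ A ⪯ Δ·1` (`Δ > 0`), a density matrix `Q`, a positive definite density
matrix `Q_0` and `ε > 0` there are `h ≤ ⌈(8/ε²) S(Q‖Q_0) Δ²⌉` tests `A_1, …, A_h ∈ 𝒯` such that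
`Q̃ = exp(log Q_0 + (ε/4Δ²) Σ_i A_i)/Tr(…)` (`= iterate η (η⁻¹ log Q_0 + Σ_i A_i)`, `gibbsWeight_prior`)
is a density matrix with `Re Tr(B(Q − Q̃)) ≤ ε` for all `B ∈ 𝒯`; and `h ≤ (16/3) S(Q‖Q_0) Δ²/ε²`.
(Sign of the exponent: see the module docstring.)
[cite: LeeRaghavendraSteurer2015, Lemma 4.6 (p. 19–20)] -/
theorem sparse_approximation_prior [Nonempty n] (𝒯 : Set (Matrix n n ℂ)) {Δ : ℝ} (hΔ : 0 < Δ)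
    (h𝒯 : ∀ A ∈ 𝒯, A.IsHermitian ∧ ((Δ : ℂ) • (1 : Matrix n n ℂ) - A).PosSemidef ∧
      ((Δ : ℂ) • (1 : Matrix n n ℂ) + A).PosSemidef)
    {Q Q₀ : Matrix n n ℂ} (hQ : Q.PosSemidef) (hQ1 : Q.trace = 1) (hQ₀ : Q₀.PosDef)
    (hQ₀1 : Q₀.trace = 1) {ε : ℝ} (hε : 0 < ε) :
    ∃ (h : ℕ) (A : Fin h → Matrix n n ℂ),
      h ≤ ⌈8 / ε ^ 2 * quantumRelEntropy Q Q₀ * Δ ^ 2⌉₊ ∧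
      (∀ i, A i ∈ 𝒯) ∧
      (iterate (ε / (4 * Δ ^ 2))
        (((ε / (4 * Δ ^ 2) : ℝ) : ℂ)⁻¹ • cfc Real.log Q₀ + ∑ i, A i)).PosSemidef ∧
      (iterate (ε / (4 * Δ ^ 2))
        (((ε / (4 * Δ ^ 2) : ℝ) : ℂ)⁻¹ • cfc Real.log Q₀ + ∑ i, A i)).trace = 1 ∧
      (∀ B ∈ 𝒯, (B * (Q - iterate (ε / (4 * Δ ^ 2))
        (((ε / (4 * Δ ^ 2) : ℝ) : ℂ)⁻¹ • cfc Real.log Q₀ + ∑ i, A i))).trace.re ≤ ε) ∧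
      (h : ℝ) ≤ 16 / 3 * quantumRelEntropy Q Q₀ * Δ ^ 2 / ε ^ 2 := by
  have hη : (ε / (4 * Δ ^ 2) : ℝ) ≠ 0 := by positivity
  have hS₀ : ((((ε / (4 * Δ ^ 2) : ℝ) : ℂ))⁻¹ • cfc Real.log Q₀ : Matrix n n ℂ).IsHermitian := by
    rw [← Complex.ofReal_inv]
    have h := Literature.LinearAlgebra.Matrix.isHermitian_cfc Q₀ Real.log
    rw [Matrix.IsHermitian, conjTranspose_smul, h.eq]
    simp
  have hmain := sparse_approximation_from 𝒯 hΔ h𝒯 hQ hQ1 hε hS₀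
  rw [potential_prior hQ hQ₀ hQ₀1 hη] at hmain
  exact hmain

end Lemma46

section RealPrior

open Matrix hiding partitionFn gibbsWeight
open Complex (ofRealHom)

/-- **The prescribed approximator with a prior**: `Q̃ = exp(log Q_0 + η S)/Tr exp(log Q_0 + η S)` for
real symmetric `Q_0, S` (matrix functions through the functional calculus).
[cite: LeeRaghavendraSteurer2015, Lemma 4.6 (p. 19, eq. (prescribed))] -/
def expStatePrior {r : ℕ} (Q₀ : Matrix (Fin r) (Fin r) ℝ) (η : ℝ) (S : Matrix (Fin r) (Fin r) ℝ) :
    Matrix (Fin r) (Fin r) ℝ :=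
  ((cfc Real.exp (cfc Real.log Q₀ + η • S)).trace)⁻¹ • cfc Real.exp (cfc Real.log Q₀ + η • S)

/-- The complex iterate started at `η⁻¹ log Q_0` is the complexified real approximator with prior.
[cite: LeeRaghavendraSteurer2015, Lemma 4.6 (p. 19, eq. (prescribed))] -/
theorem iterate_prior_map_ofReal {r : ℕ} {η : ℝ} (hη : η ≠ 0) {Q₀ S : Matrix (Fin r) (Fin r) ℝ}
    (hQ₀ : Q₀.IsSymm) (hS : S.IsSymm) :
    Lemma46.iterate η ((η : ℂ)⁻¹ • cfc Real.log (Q₀.map ofRealHom) + S.map ofRealHom) =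
      (expStatePrior Q₀ η S).map ofRealHom := by
  have hX : (cfc Real.log Q₀ + η • S).IsSymm := by
    have h1 : (cfc Real.log Q₀).IsSymm := by
      have h := (Literature.LinearAlgebra.Matrix.isHermitian_cfc Q₀ Real.log).eq
      rwa [conjTranspose_eq_transpose_of_trivial] at h
    unfold Matrix.IsSymm at h1 hS ⊢
    rw [transpose_add, transpose_smul, h1, hS]
  have hW : Matrix.gibbsWeight (-η) ((η : ℂ)⁻¹ • cfc Real.log (Q₀.map ofRealHom) + S.map ofRealHom) =
      (cfc Real.exp (cfc Real.log Q₀ + η • S)).map ofRealHom := by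
    rw [Lemma46.gibbsWeight_prior hη, Lemma42.cfc_map_ofReal hQ₀, ← Lemma42.map_ofReal_smul,
      ← Matrix.map_add _ (map_add ofRealHom), ← Lemma42.cfc_map_ofReal hX,
      CFC.real_exp_eq_normedSpace_exp (Lemma42.isHermitian_map_ofReal hX).isSelfAdjoint]
  rw [Lemma46.iterate, Matrix.partitionFn, hW, Lemma42.trace_map_ofReal, expStatePrior,
    Lemma42.map_ofReal_smul, Complex.ofReal_inv]

/-- The complexified relative entropy is the real one: `S(Q ⊗ ℂ ‖ Q_0 ⊗ ℂ) = S(Q‖Q_0)`.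
[cite: LeeRaghavendraSteurer2015, §2.1 (p. 10: "S(X‖Y) = Tr(X·(log X − log Y))")] -/
theorem quantumRelEntropy_map_ofReal {r : ℕ} {Q Q₀ : Matrix (Fin r) (Fin r) ℝ} (hQ : Q.IsSymm)
    (hQ₀ : Q₀.IsSymm) :
    Literature.InformationTheory.Entropy.quantumRelEntropy (Q.map ofRealHom) (Q₀.map ofRealHom) =
      relEntropy Q Q₀ := by
  rw [Literature.InformationTheory.Entropy.quantumRelEntropy, Lemma42.cfc_map_ofReal hQ,
    Lemma42.cfc_map_ofReal hQ₀, ← Matrix.map_sub _ (map_sub ofRealHom), ← Matrix.map_mul,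
    Lemma42.trace_map_ofReal, Complex.ofReal_re, relEntropy]

/-- A real positive definite matrix is complex positive definite. [folklore] -/
private theorem posDef_map_ofReal {r : ℕ} {Q₀ : Matrix (Fin r) (Fin r) ℝ} (hQ₀ : Q₀.PosDef) :
    (Q₀.map ofRealHom).PosDef := by
  refine (Lemma42.posSemidef_map_ofReal hQ₀.posSemidef).posDef_iff_isUnit.mpr ?_
  rw [Matrix.isUnit_iff_isUnit_det, ← RingHom.mapMatrix_apply, ← RingHom.map_det]
  exact ((Matrix.isUnit_iff_isUnit_det _).mp hQ₀.isUnit).map ofRealHom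

/-- The approximator with prior is a density matrix (`r ≥ 1`). [cite: LeeRaghavendraSteurer2015, Lemma 4.6 (p. 19: "Q̃ ∈ 𝒟(H)")] -/
theorem isDensityMatrix_expStatePrior {r : ℕ} (hr : 0 < r) (Q₀ : Matrix (Fin r) (Fin r) ℝ) (η : ℝ)
    {S : Matrix (Fin r) (Fin r) ℝ} (hX : (cfc Real.log Q₀ + η • S).IsSymm) :
    IsDensityMatrix (expStatePrior Q₀ η S) := by
  haveI : Nonempty (Fin r) := ⟨⟨0, hr⟩⟩
  have hpos : 0 < (cfc Real.exp (cfc Real.log Q₀ + η • S)).trace := by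
    rw [Literature.LinearAlgebra.Matrix.trace_cfc_eq_sum_eigenvalues (Lemma42.isHermitian_of_isSymm hX)]
    simp only [RCLike.ofReal_real_eq_id, id_eq]
    exact sum_pos (fun i _ => Real.exp_pos _) univ_nonempty
  refine ⟨?_, ?_⟩
  · exact (Literature.LinearAlgebra.Matrix.posSemidef_cfc_of_nonneg' _
      (fun x => (Real.exp_pos x).le)).smul (inv_nonneg.mpr hpos.le)
  · rw [expStatePrior, trace_smul, smul_eq_mul, inv_mul_cancel₀ hpos.ne']

/-- **Klein's inequality in the vocabulary of `DensityMatrixApproximation.lean`**: `S(Q‖Q_0) ≥ 0` for a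
density matrix `Q` and a positive definite density matrix `Q_0`.
[cite: LeeRaghavendraSteurer2015, proof of Lemma 4.6 (p. 20: "the fact that S(Q‖Q_T) ≥ 0")]
[cite: NielsenChuang2010, §11.3 Theorem 11.7 (Klein's inequality)] -/
theorem relEntropy_nonneg {r : ℕ} {Q Q₀ : Matrix (Fin r) (Fin r) ℝ} (hQ : IsDensityMatrix Q)
    (hQ₀ : IsDensityMatrix Q₀) (hQ₀pd : Q₀.PosDef) : 0 ≤ relEntropy Q Q₀ := by
  rcases Nat.eq_zero_or_pos r with h0 | hr
  · subst h0
    simp [relEntropy]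
  haveI : Nonempty (Fin r) := ⟨⟨0, hr⟩⟩
  have hQsymm : Q.IsSymm := by
    have h := hQ.1.1.eq
    rwa [conjTranspose_eq_transpose_of_trivial] at h
  have hQ₀symm : Q₀.IsSymm := by
    have h := hQ₀.1.1.eq
    rwa [conjTranspose_eq_transpose_of_trivial] at h
  rw [← quantumRelEntropy_map_ofReal hQsymm hQ₀symm]
  refine Lemma46.quantumRelEntropy_nonneg (Lemma42.posSemidef_map_ofReal hQ.1) ?_
    (posDef_map_ofReal hQ₀pd) ?_
  · rw [Lemma42.trace_map_ofReal, hQ.2, Complex.ofReal_one]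
  · rw [Lemma42.trace_map_ofReal, hQ₀.2, Complex.ofReal_one]

/-- **Lee–Raghavendra–Steurer 2015, Lemma 4.6 with a positive definite prior `Q_0` — PROVED** (real
symmetric vocabulary): for tests `−Δ·Id ⪯ A ⪯ Δ·Id` (`Δ > 0`), density matrices `Q, Q_0` with `Q_0`
positive definite, and `ε > 0`, there are `h ≤ ⌈(8/ε²) S(Q‖Q_0) Δ²⌉` tests `A_1, …, A_h ∈ 𝒯` such that
`Q̃ = exp(log Q_0 + (ε/4Δ²) Σ_i A_i)/Tr(…)` (`expStatePrior`) is a density matrix with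
`Tr(B(Q − Q̃)) ≤ ε` for every `B ∈ 𝒯`; moreover `h ≤ (16/3) S(Q‖Q_0) Δ²/ε²`.  (The printed "`Q, Q_0 ∈
𝒟(H)`" needs `S(Q‖Q_0) < ∞`; positive definiteness of `Q_0` is the clean sufficient condition.  Sign of
the exponent and "`h ≤ ⌈…⌉`": module docstring.)  [cite: LeeRaghavendraSteurer2015, Lemma 4.6 (p. 19–20)] -/
theorem LeeRaghavendraSteurer2015_lemma46_prior {r : ℕ} (𝒯 : Set (Matrix (Fin r) (Fin r) ℝ)) {Δ : ℝ}
    (hΔ : 0 < Δ) (h𝒯 : ∀ A ∈ 𝒯, A.IsSymm ∧ -(Δ • (1 : Matrix (Fin r) (Fin r) ℝ)) ≤ A ∧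
      A ≤ Δ • (1 : Matrix (Fin r) (Fin r) ℝ))
    {Q Q₀ : Matrix (Fin r) (Fin r) ℝ} (hQ : IsDensityMatrix Q) (hQ₀ : IsDensityMatrix Q₀)
    (hQ₀pd : Q₀.PosDef) {ε : ℝ} (hε : 0 < ε) :
    ∃ (h : ℕ) (A : Fin h → Matrix (Fin r) (Fin r) ℝ),
      h ≤ ⌈8 / ε ^ 2 * relEntropy Q Q₀ * Δ ^ 2⌉₊ ∧ (∀ i, A i ∈ 𝒯) ∧
      IsDensityMatrix (expStatePrior Q₀ (ε / (4 * Δ ^ 2)) (∑ i, A i)) ∧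
      (∀ B ∈ 𝒯, (B * (Q - expStatePrior Q₀ (ε / (4 * Δ ^ 2)) (∑ i, A i))).trace ≤ ε) ∧
      (h : ℝ) ≤ 16 / 3 * relEntropy Q Q₀ * Δ ^ 2 / ε ^ 2 := by
  have hr : 0 < r := by
    rcases Nat.eq_zero_or_pos r with h | h
    · exfalso
      subst h
      have := hQ.2
      rw [Matrix.trace_fin_zero] at this
      exact zero_ne_one this
    · exact h
  haveI : Nonempty (Fin r) := ⟨⟨0, hr⟩⟩
  have hQsymm : Q.IsSymm := by
    have h := hQ.1.1.eq
    rwa [conjTranspose_eq_transpose_of_trivial] at h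
  have hQ₀symm : Q₀.IsSymm := by
    have h := hQ₀.1.1.eq
    rwa [conjTranspose_eq_transpose_of_trivial] at h
  have hQ1 : (Q.map ofRealHom).trace = 1 := by
    rw [Lemma42.trace_map_ofReal, hQ.2, Complex.ofReal_one]
  have hQ₀1 : (Q₀.map ofRealHom).trace = 1 := by
    rw [Lemma42.trace_map_ofReal, hQ₀.2, Complex.ofReal_one]
  set 𝒯' : Set (Matrix (Fin r) (Fin r) ℂ) := (fun A => A.map ofRealHom) '' 𝒯 with h𝒯'_def
  have hone : (1 : Matrix (Fin r) (Fin r) ℝ).map ofRealHom = 1 :=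
    Matrix.map_one _ (map_zero ofRealHom) (map_one ofRealHom)
  have h𝒯' : ∀ A' ∈ 𝒯', A'.IsHermitian ∧ ((Δ : ℂ) • (1 : Matrix (Fin r) (Fin r) ℂ) - A').PosSemidef ∧
      ((Δ : ℂ) • (1 : Matrix (Fin r) (Fin r) ℂ) + A').PosSemidef := by
    rintro A' ⟨A, hA, rfl⟩
    obtain ⟨hAs, hAge, hAle⟩ := h𝒯 A hA
    refine ⟨Lemma42.isHermitian_map_ofReal hAs, ?_, ?_⟩
    · have h1 : (Δ • (1 : Matrix (Fin r) (Fin r) ℝ) - A).PosSemidef := Matrix.le_iff.mp hAle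
      have h2 := Lemma42.posSemidef_map_ofReal h1
      rw [Matrix.map_sub _ (map_sub ofRealHom), Lemma42.map_ofReal_smul, hone] at h2
      exact h2
    · have h1 : (Δ • (1 : Matrix (Fin r) (Fin r) ℝ) + A).PosSemidef := by
        have := Matrix.le_iff.mp hAge
        rwa [sub_neg_eq_add, add_comm] at this
      have h2 := Lemma42.posSemidef_map_ofReal h1
      rw [Matrix.map_add _ (map_add ofRealHom), Lemma42.map_ofReal_smul, hone] at h2
      exact h2
  obtain ⟨h, A', hh, hA', -, -, hgood, hhreal⟩ :=
    Lemma46.sparse_approximation_prior 𝒯' hΔ h𝒯' (Lemma42.posSemidef_map_ofReal hQ.1) hQ1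
      (posDef_map_ofReal hQ₀pd) hQ₀1 hε
  have hpre : ∀ i, ∃ A ∈ 𝒯, A.map ofRealHom = A' i := fun i => hA' i
  choose A hA𝒯 hAeq using hpre
  have hS : ∑ i, A' i = (∑ i, A i).map ofRealHom := by
    rw [map_ofReal_sum]
    exact sum_congr rfl fun i _ => (hAeq i).symm
  have hSsymm : (∑ i, A i).IsSymm := by
    unfold Matrix.IsSymm
    rw [Matrix.transpose_sum]
    exact sum_congr rfl fun i _ => (h𝒯 _ (hA𝒯 i)).1
  have hX : (cfc Real.log Q₀ + (ε / (4 * Δ ^ 2)) • ∑ i, A i).IsSymm := by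
    have h1 : (cfc Real.log Q₀).IsSymm := by
      have h := (Literature.LinearAlgebra.Matrix.isHermitian_cfc Q₀ Real.log).eq
      rwa [conjTranspose_eq_transpose_of_trivial] at h
    unfold Matrix.IsSymm at h1 hSsymm ⊢
    rw [transpose_add, transpose_smul, h1, hSsymm]
  have hent := quantumRelEntropy_map_ofReal hQsymm hQ₀symm
  rw [hent] at hh hhreal
  have hη : (ε / (4 * Δ ^ 2) : ℝ) ≠ 0 := by positivity
  refine ⟨h, A, hh, hA𝒯, isDensityMatrix_expStatePrior hr Q₀ _ hX, ?_, hhreal⟩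
  intro B hB
  have hB' : B.map ofRealHom ∈ 𝒯' := ⟨B, hB, rfl⟩
  have h1 := hgood _ hB'
  rw [hS, iterate_prior_map_ofReal hη hQ₀symm hSsymm,
    ← Matrix.map_sub _ (map_sub ofRealHom), ← Matrix.map_mul, Lemma42.trace_map_ofReal,
    Complex.ofReal_re] at h1
  exact h1

end RealPrior

end Literature.Combinatorics.Optimization

end
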